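import Summits.QuantumFields.YangMills.Theorems.BalabanUVNodesN06Level13D2LayerAtPinsPUW
import Summits.QuantumFields.YangMills.Theorems.BalabanUVNodesN06StateLayerAtPinsPUWPar
import Summits.QuantumFields.YangMills.Theorems.BalabanUVNodesN06G0QstarTransferLegAtPinsPULaws
import Summits.QuantumFields.YangMills.Theorems.BalabanUVNodesN06D2SupPrechainV2AtPinsPUWQ
import Summits.QuantumFields.YangMills.Theorems.BalabanUVNodesN06StateLayerAtPinsPUW
import Summits.QuantumFields.YangMills.Theorems.BalabanUVNodesN06D2SupPrechainV2AtPinsPUW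
import Summits.QuantumFields.YangMills.Theorems.BalabanUVNodesN06XdYdLegAtPinsPhysPU
import Summits.QuantumFields.YangMills.Theorems.BalabanUVNodesN06DvLettersLegAtPinsPU
import Summits.QuantumFields.YangMills.Theorems.BalabanUVNodesN06G0QstarTransferLegAtPinsPU
import Summits.QuantumFields.YangMills.Theorems.BalabanUVNodesN06DgDvdLegAtPinsT
import Literature.MathematicalPhysics.QuantumFieldTheory.Balaban1983to89.B9GradLetterTransportedSupSource
import Literature.MathematicalPhysics.QuantumFieldTheory.Balaban1983to89.B9LettersZSchemasMono
import Literature.MathematicalPhysics.QuantumFieldTheory.Balaban1983to89.B9StateAprioriL1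

/-!
# CASCADE-K «K3-D» (director-ym №383) — THE SITE-TRANSPORTER-PARAMETRIC RE-PRESS of `N06Level13D2LayerAtPinsPUW`: `level13_d2_layer_of_pinsP_geo9Y_parQ` = the landed `level13_d2_layer_of_pinsP_geo9Y` VERBATIM with the record's symmetric site transporter `parSymY x.toKIdx` replaced by a PARAMETER `parKnitY : ∀ i, SiteParY _ i` (every `GpY ∕ GpPhysY ∕ TpicoK ∕ T2coK ∕ RcoK …` letter read at `parKnitY x.toKIdx`; proofs verbatim — the callees are transporter-generic or their landed `_par` twins are called); KD″ (L1, dag-n06-l g40 on dag-n06-d g27's split I.21349): the record's transporter SPECIALISED to print's knit table `parKnitY` and the (3.137) letter DERIVED INSIDE the layer by dag-n06-l's KNIT prechain `…D2SupPrechainV2AtPinsPUWQ.d2sup_prechain_v2_of_pins_knit` (row 26 for `QG̃Q⋆` at print's (3.115) knit pair); the straight-pair-only inputs `c' hY hΔA` and the now-idle pin `hQsco12` GONE, the Sect.-D pins `hS0co12 hGco12 hCco12 hΔ2def hO` RETYPED in the `𝔮`-generic currency, NEW displayed knit inputs `𝔮 𝔮s h𝔮 h𝔮s hadj Δ hΔdef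 α₀' aK hα' hαQ hα3 hα2 haK hKpl hT16 hΔ hGDsym BQ15 hBQ15 hQ15` + the `Q⋆` class letter `hqsK` (the G₀Q⋆ transfer letters come from `…TransferLegAtPinsPULaws`); conclusion UNCHANGED (exports `aD θ₂` and the (3.137) conjunct (8)).  At `parKnitY := fun i => parSymY i` these ARE the originals; at the knit transporter they serve the knit certificate's Sect.-D network «KD» (dag-n06-d g25∕g26, HOME `K3D-CENSUS-g25.md`).  Seat `pub-ymgap-dag-n06-d` (g26), 2026-08-30.  The original module text below applies word for word otherwise.
#

# BalabanUVNodes ∕ N06 ([B9], `Dag.B9_main`) — THE LEVEL-13 LETTERS, THE Δ⁽²⁾ LETTER (3.137) DERIVED, AND THE U8 STATE LAYER OF THE STAGE-11 CERTIFICATE, AS ONE LEG (P-D2 cut B″)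

Track A of `YM-PLAN.md` (cell `pub-ymgap`, HUMAN RULING D-0062), node **N06** = [Balaban1985BackgroundPropagators] Thms 3.1–3.15; seat `pub-ymgap-dag-n06-d` (gen 22).  A LEG of the
stage-11 certificate, count-neutral; the Δ⁽²⁾ twin of `…N06Level13LayerAtPinsPUW` (✓p764267).  WHAT.  (§1) the level-13 letters at the rate `δ13` exactly as in the sibling
(dag-n06-c `dgDvd_pdgDvd_of_pinsT_all`, this seat's `hXd ∕ dgDH_dgDHd ∕ pYDH_of_pinsP_geo9Y`, dag-n06-c `dv_letters_of_pins ∕ pXDv_of_pins_KX`, dag-n06-l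
`g0qstar_transfer_letters_of_pins`); (§2a) dag-n06-l's P-D2 prechain v2 ✓p764766 `…N06D2SupPrechainV2AtPinsPUW.d2sup_prechain_v2_of_pins` (cut 1 of LOCATED-D2-CYCLE-2) — a PASS of the U8 layer at the FLAT
residual, the Δ⁽²⁾-free G_D resolvent identity from the T_π block-L² letter, G_D's scaled sup letter, then (3.132)'s C-letter DERIVED Δ⁽²⁾-free (the G − G₀ entry, row 26 for (QG̃Q*)⁻¹ alone, `c2_pinsB`) and [5] (149)'s C⁽²⁾ form letter ⟹ the Δ⁽²⁾ LETTER
(3.137) `HasMajorant blk (D2coK … (Δ2 x) U) (θ₂·Mα₀·len⁻²·e^{−δ₂ d})` on a sub-regime `aD`, for def-Y's `Δ2 x = delta2OfY … (GpPhysY …) (𝔠 x).form` (the certificate's `𝔯`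
pinned to `resYOfC2P 𝔠`); (§2b) the U8 state layer of record `hStateTuplesW_of_pinsP_geo9Y` at `(δK, δP)` on `aD`, fed that letter.  ONE theorem ★★★
`level13_d2_layer_of_pinsP_geo9Y`; inputs = the sibling's minus `θ₂ hθ₂ hD2` plus the prechain's P-D2 inputs (`𝔠 hΔ2def hinvG0 hpos12 hsym12 hl0 htpi`, the rates
`BL0 δL0 t2L δT σF ρG`, the pins `hS0co12 hGco12 hCco12`, `hRP2`, G_A's inverse `O hO`, the (3.35)∕(3.36) upgrade `hY`, Δ_A's positivity `hΔA` (Thm 3.11's regime `a311 M311`), the neighbour count `hnbr`, the letter `hC2` with `κC δC2`); output = the sibling's plus `aD θ₂` and the Δ⁽²⁾ letter family.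

HONEST LABEL: helper (plumbing of landed legs), count-neutral; every analytic member is a displayed HYPOTHESIS of printed species ([5] (149)
included); N06 NOT discharged; nothing continuum ∕ OS ∕ mass gap ∕ Clay.
[cite: Balaban1985BackgroundPropagators, Thm 3.3 (3.42)–(3.47) pp.397–399, (3.126)–(3.133) pp.421–422, (3.134)–(3.138) pp.422–423, (3.151)–(3.153) p.426;
Balaban1984PropagatorsII, (2.51)–(2.56) pp.232–233, Lemma 2.1 (2.60)–(2.61) p.234; Balaban1985Averaging, (149) p.40]
-/

noncomputable section

namespace Summit.QuantumFields.YangMills.BalabanUVNodes.N06Level13D2LayerAtPinsPUWParQ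

open Literature.MathematicalPhysics.QuantumFieldTheory.Balaban1983to89 open Literature.MathematicalPhysics.QuantumFieldTheory.Balaban1983to89.Node00 open Literature.MathematicalPhysics.QuantumFieldTheory.Balaban1983to89.Node00.OpsYSectDCoords (DvcoKH DvscoKH QscoKH RcoK T2coK TpicoK cR39_trBasis_pos) open Literature.MathematicalPhysics.QuantumFieldTheory.Balaban1983to89.B9Thm39ReadingCoords (basisBound39 cR39 cR39_nonneg coordBound39) open Literature.MathematicalPhysics.QuantumFieldTheory.Balaban1983to89.B9Thm34Ext (toB6) open Literature.MathematicalPhysics.QuantumFieldTheory.Balaban1983to89.B11SectG (BlockNorm HasMaj RowSum) open Literature.MathematicalPhysics.QuantumFieldTheory.Balaban1983to89.B9Thm312Whole (GeoOK Ops cNorm) open Literature.MathematicalPhysics.QuantumFieldTheory.Balaban1983to89.B9Thm312WholeClasses (cNormR rwt rwt_nonneg) open Literature.MathematicalPhysics.QuantumFieldTheory.Balaban1983to89.B9CoReadingCoords (DcoK DscoK GcoK XBK blkBK cdBₗ cdsBₗ coordOpK) open Literature.MathematicalPhysics.QuantumFieldTheory.Balaban1983to89.B9CoReadingCoordsS (GcoS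 XSK blkSK sIK) open Literature.MathematicalPhysics.QuantumFieldTheory.Balaban1983to89.B9CoReadingCoordsH (XHK blkHK) open Literature.MathematicalPhysics.QuantumFieldTheory.Balaban1983to89.B9CoReadingCoordsTranspose (TrIdx trBasis) open Literature.MathematicalPhysics.QuantumFieldTheory.Balaban1983to89.B9PinMembersKLevelV1 (MemberY bg9Y geo9Y geo9Y_M) open Literature.MathematicalPhysics.QuantumFieldTheory.Balaban1983to89.B9BackgroundsKLevelV1R (MemOfFam RegFamY bg9YR mem_of_reg335R) open Literature.MathematicalPhysics.QuantumFieldTheory.Balaban1983to89.B9GeoLemma21KLevelV1 (geo9Y_dist_comm geo9Y_dist_triangle geo9Y_len_pos rowSum261_geo9Y)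
open Literature.MathematicalPhysics.QuantumFieldTheory.Balaban1983to89.Node00 (deltaAQY GDQY delta2OfQY QGQOfQY) open Literature.MathematicalPhysics.QuantumFieldTheory.Balaban1983to89.Node00.OpsYOps312OfRecordPar (S0coKq QcoKHq CcoKq) open Literature.MathematicalPhysics.QuantumFieldTheory.Balaban1983to89.B9B8AveragingJunction (parKnitY) open Literature.MathematicalPhysics.QuantumFieldTheory.Balaban1983to89.B9Thm311ReadingCoords (IsAdjTr IsSymmTr) open Literature.MathematicalPhysics.QuantumFieldTheory.Balaban1983to89.B9Eq316AveragingTransposeZd (alphaQ) open Literature.MathematicalPhysics.QuantumFieldTheory.Balaban1983to89.B9C2FormBoxRegimeY (Kpl) open Literature.MathematicalPhysics.QuantumFieldTheory.Balaban1983to89.B9Eq3115KnitLetterYOnto (kCol) open Literature.MathematicalPhysics.QuantumFieldTheory.Balaban1983to89.B9Eq3132TentBumps (Cth) open Literature.MathematicalPhysics.QuantumFieldTheory.Balaban1983to89.B7Prop2Explicit (C0 c2') open Literature.MathematicalPhysics.QuantumFieldTheory.Balaban1983to89.B9CoReadingCoordsH (blkHK) open Literature.MathematicalPhysics.QuantumFieldTheory.Balaban1983to89.B6KLevelCensusIndexV1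 (kGeo) open Literature.MathematicalPhysics.QuantumFieldTheory.Balaban1983to89.B6RandomWalkHom (HasMajorantHom)
open Literature.MathematicalPhysics.QuantumFieldTheory.Balaban1983to89.B9GeoNormsKLevelV1 (geo9K geo9K_dist_nonneg) open Literature.MathematicalPhysics.QuantumFieldTheory.Balaban1983to89.B7Prop2SpecialUnitary (specialUnitaryUnits specialUnitaryUnits_le_U1 specialUnitaryUnits_le_unitaryUnits) open Literature.MathematicalPhysics.QuantumFieldTheory.Balaban1983to89.B9PerturbationMajorantAlgebra (CurrentMaj Proj349Maj Thm31GpMaj hasMaj_weaken) open Literature.MathematicalPhysics.QuantumFieldTheory.Balaban1983to89.B9PerturbationMajorantsAtLetters (BcoKH BdcoKH PcoK rcoK_eq) open Literature.MathematicalPhysics.QuantumFieldTheory.Balaban1983to89.B9MultiscaleSmoothPartitionYNear (rNear) open Literature.MathematicalPhysics.QuantumFieldTheory.Balaban1983to89.B9MultiscaleSmoothPartitionYLip (CLip CLip_nonneg) open Literature.MathematicalPhysics.QuantumFieldTheory.Balaban1983to89.B9SmoothHolderClassP (bHZKP bHZKPG bHZKP_κ bHZPG) open Literature.MathematicalPhysics.QuantumFieldTheory.Balaban1983to89.B9GradViaDivLettersTransported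 (taxiB taxiS) open Literature.MathematicalPhysics.QuantumFieldTheory.Balaban1983to89.B9PerturbationSplitAtLetters (Ta2LcoK TaLcoK Tb2LcoKH TbLcoKH) open Literature.MathematicalPhysics.QuantumFieldTheory.Balaban1983to89.B9PerturbationL2Delta2 (D2coK) open Literature.MathematicalPhysics.QuantumFieldTheory.Balaban1983to89.Node00.OpsYSectDCoords (S0coK CcoK) open Literature.MathematicalPhysics.QuantumFieldTheory.Balaban1983to89.B9Eq3132SectDLetters (GDY) open Literature.MathematicalPhysics.QuantumFieldTheory.Balaban1983to89.B9Delta2FormMajorant (C2FormMaj) open Literature.MathematicalPhysics.QuantumFieldTheory.Balaban1983to89.B9BackgroundsKLevelV1P (bg9YP) open Literature.MathematicalPhysics.QuantumFieldTheory.Balaban1983to89.B9PinGeometryKLevelV1 (c35Y) open Literature.MathematicalPhysics.QuantumFieldTheory.Balaban1983to89.B9SmoothHolderClassPProducers (CTel CTel_nonneg) open Literature.MathematicalPhysics.QuantumFieldTheory.Balaban1983to89.B9RowSum261DefiniteFaces (rowConst261 rowConst261_nonneg) open Literature.MathematicalPhysics.QuantumFieldTheory.Balaban1983to89.B9SectDSup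 (weightNorm) open Literature.MathematicalPhysics.QuantumFieldTheory.Balaban1983to89.B6RandomWalk (HasMajorant)
open Literature.MathematicalPhysics.QuantumFieldTheory.Balaban1983to89.B6RandomWalkHom (HasMajorantHom) open Literature.MathematicalPhysics.QuantumFieldTheory.Balaban1983to89.B9Thm312WholeStepRegular (LettersS3131 StepS) open Literature.MathematicalPhysics.QuantumFieldTheory.Balaban1983to89.B9CoReadingCoordsHolder (PK blkPK probeK w₀K) open Literature.MathematicalPhysics.QuantumFieldTheory.Balaban1983to89.B9CoReadingCoordsHolderAdm (holderProbesKA wKA) open Literature.MathematicalPhysics.QuantumFieldTheory.Balaban1983to89.B9RWSums343Holder (HolderProbes) open Literature.MathematicalPhysics.QuantumFieldTheory.Balaban1983to89.B9Thm313WholeDir (Thm33G0DirR) open Literature.MathematicalPhysics.QuantumFieldTheory.Balaban1983to89.B9Thm313WholeDirInputBC (Letters313IML) open Literature.MathematicalPhysics.QuantumFieldTheory.Balaban1983to89.B9LettersHZAtOne (plateau_pos) open Literature.MathematicalPhysics.QuantumFieldTheory.Balaban1983to89.B9CoReadingCoordsInput (bHK) open Literature.MathematicalPhysics.QuantumFieldTheory.Balaban1983to89.B9CoReadingCoordsInputS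 (bHS) open Literature.MathematicalPhysics.QuantumFieldTheory.Balaban1983to89.B9CoRealizesRelAtLetters (RelB) open Literature.MathematicalPhysics.QuantumFieldTheory.Balaban1983to89.B9Thm33G0ProbeZeroAtCutPins (pX0_of_pins) open Literature.MathematicalPhysics.QuantumFieldTheory.Balaban1983to89.B6GlobalChartV1 (PV blkV1) open Literature.MathematicalPhysics.QuantumFieldTheory.Balaban1983to89.B6Ineq2142KLevelV1 (lvl β) open Literature.MathematicalPhysics.QuantumFieldTheory.Balaban1983to89.B6Geom246MultiLevelTorus (geomT) open Summit.QuantumFields.YangMills.BalabanUVNodes.N06HolderPinsGradedAtRecord (links_le_one) open Summit.QuantumFields.YangMills.BalabanUVNodes.N06TbHLegAtPinsPhysPU (htbH_of_pinsP43_geo9Y)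
open Summit.QuantumFields.YangMills.BalabanUVNodes.N06LettersSAtPinsPU (hLettersS_of_pinsP44_geo9Y) open Summit.QuantumFields.YangMills.BalabanUVNodes.N06StateClassFactsAtPinsPU (hStateFacts_of_pinsP_geo9Y) open Summit.QuantumFields.YangMills.BalabanUVNodes.N06StateProducerG0AtPinsPU (hG0S2_of_pinsP_geo9Y) open Summit.QuantumFields.YangMills.BalabanUVNodes.N06StateProducersAAtPinsPU (hProducersA_of_pinsP_geo9Y) open Summit.QuantumFields.YangMills.BalabanUVNodes.N06StateProducersBAtPinsPUW (hProducersBW_of_pinsP_geo9Y) open Summit.QuantumFields.YangMills.BalabanUVNodes.N06StatePairsAtPinsPU (hStatePairs_of_pinsP_geo9Y) open Summit.QuantumFields.YangMills.BalabanUVNodes.N06StateAssemblyAtPinsPUW (hStateAssemblyW_of_faces) open Literature.MathematicalPhysics.QuantumFieldTheory.Balaban1983to89.B9SectDL2Decay (BlockBd) open Literature.MathematicalPhysics.QuantumFieldTheory.Balaban1983to89.B9Thm312WholeDir (Thm33G0Dir Thm33G0L2M) open Literature.MathematicalPhysics.QuantumFieldTheory.Balaban1983to89.B9RWSums343to347Whole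 (Facts347) open Literature.MathematicalPhysics.QuantumFieldTheory.Balaban1983to89.B9RWSums347DefiniteFaces (exp261 facts347_exp261_geo9Y geo9Y_scalars) open Literature.MathematicalPhysics.QuantumFieldTheory.Balaban1983to89.B9GradViaDivLettersAtPins (DvcoKH_eq_sum JcoKH rJ) open Literature.MathematicalPhysics.QuantumFieldTheory.Balaban1983to89.B9Thm313WholeDvAtPinsR (dGDv_pinsB dGDvd_pinsB gD2_pinsB gDv_pinsB pXDv_pinsB) open Literature.MathematicalPhysics.QuantumFieldTheory.Balaban1983to89.Node00.OpsYNablaBridge (chartY) open Literature.MathematicalPhysics.QuantumFieldTheory.Balaban1983to89.B9BackgroundsKLevelV1P (bg9KP mem_of_reg335P)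
open Literature.MathematicalPhysics.QuantumFieldTheory.Balaban1983to89.B9SmoothHolderClassPI (bHZKPIfam bHZPIfam transfer_threshold_geo9K) open Literature.MathematicalPhysics.QuantumFieldTheory.Balaban1983to89.B9SmoothHolderClassTClosure (abs_cf_eq_nKT) open Literature.MathematicalPhysics.QuantumFieldTheory.Balaban1983to89.B9SectBGpLettersY (norm_le_one_and_inv_of_mem) open Literature.MathematicalPhysics.QuantumFieldTheory.Balaban1983to89.B9GradLetterTransportedInputClassesPI (hasMaj_dgDv_of_h44m hasMaj_pdgDv_of_h45m jLadder_hyp_of_reg335P) open Literature.MathematicalPhysics.QuantumFieldTheory.Balaban1983to89.B6KLevelCensusIndexV1 (Adm kGeo) open T4RelativeLadder (UnitaryLike) open Literature.MathematicalPhysics.QuantumFieldTheory.Balaban1983to89.B9RWSums346SecondDiff (DirOps310) open Literature.MathematicalPhysics.QuantumFieldTheory.Balaban1983to89.B9Thm310Whole (Ops310) open Literature.MathematicalPhysics.QuantumFieldTheory.Balaban1983to89.B9Thm313WholeDvHolderAtPinsGraded (CJG CJG_nonneg thetaL thetaL_nonneg) open Literature.MathematicalPhysics.QuantumFieldTheory.Balaban1983to89.B9TaxiTransportLadder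 (plaqV) open Literature.MathematicalPhysics.QuantumFieldTheory.Balaban1983to89.B9Thm313WholeDvHolderAtPinsPrint (hJ_print) open Literature.MathematicalPhysics.QuantumFieldTheory.Balaban1983to89.B9Thm313WholeDvHolderFromDdsFree (pYDH_of_h45Y_one) open Literature.MathematicalPhysics.QuantumFieldTheory.Balaban1983to89.B6Prop22KLevelTorusCensusEta (nKT) open Summit.QuantumFields.YangMills.BalabanUVNodes.N06XdLegAtPinsPhysRU (one_le_CLip) 
open Literature.MathematicalPhysics.QuantumFieldTheory.Balaban1983to89.B9DivViaGradLettersAtPins (DvscoKH_eq_sum JTcoKH) open Literature.MathematicalPhysics.QuantumFieldTheory.Balaban1983to89.B9PerturbationMajorantsAtLettersPhys (rcoK_GpPhysY) open Literature.MathematicalPhysics.QuantumFieldTheory.Balaban1983to89.B9LettersZQstarFieldsAtPinsR (gQs1_pinsB pXQs_pinsB) open scoped Matrix.Norms.L2Operator open Literature.MathematicalPhysics.QuantumFieldTheory.Balaban1983to89.B9Thm312Whole (Thm33G0) open Literature.MathematicalPhysics.QuantumFieldTheory.Balaban1983to89.B9LettersZSchemasMono (kernel_mono) open Literature.MathematicalPhysics.QuantumFieldTheory.Balaban1983to89.B9StateAprioriL1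 (exists_l1_control_bHK) open Literature.MathematicalPhysics.QuantumFieldTheory.Balaban1983to89.B9GradLetterTransportedSupSource (hasMaj_bHZPIfam_of_supBlocks) open Summit.QuantumFields.YangMills.BalabanUVNodes.N06StateLayerAtPinsPUW (hStateTuplesW_of_pinsP_geo9Y) open Summit.QuantumFields.YangMills.BalabanUVNodes.N06D2SupPrechainV2AtPinsPUW (d2sup_prechain_v2_of_pins) open B9BackgroundsKLevelV1R (regY335 regY336) open B9RWSumsReadsNbr (nbr) open B9Thm311ReadingCoords (PosDefTr) open Literature.MathematicalPhysics.QuantumFieldTheory.Balaban1983to89.B9SectDL2Decay (BlockBd) open Literature.MathematicalPhysics.QuantumFieldTheory.Balaban1983to89.B9PerturbationL2Delta2 (D2coK) open Literature.MathematicalPhysics.QuantumFieldTheory.Balaban1983to89.Node00.OpsYSectDCoords (S0coK CcoK) open Literature.MathematicalPhysics.QuantumFieldTheory.Balaban1983to89.B9Eq3132SectDLetters (GDY) open Literature.MathematicalPhysics.QuantumFieldTheory.Balaban1983to89.B9Delta2FormMajorant (C2FormMaj) open Literature.MathematicalPhysics.QuantumFieldTheory.Balaban1983to89.B9BackgroundsKLevelV1P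 (bg9YP) open Literature.MathematicalPhysics.QuantumFieldTheory.Balaban1983to89.B9PinGeometryKLevelV1 (c35Y) open Summit.QuantumFields.YangMills.BalabanUVNodes.N06XdYdLegAtPinsPhysPU (hXd_of_pinsP_geo9Y pYDH_of_pinsP_geo9Y) open Summit.QuantumFields.YangMills.BalabanUVNodes.N06DgLegAtPinsPhysPU (dgDH_dgDHd_of_pinsP_geo9Y) open Summit.QuantumFields.YangMills.BalabanUVNodes.N06DvLettersLegAtPinsPU (dv_letters_of_pins pXDv_of_pins_KX)
open Summit.QuantumFields.YangMills.BalabanUVNodes.N06G0QstarTransferLegAtPinsPU (g0qstar_transfer_letters_of_pins) open Summit.QuantumFields.YangMills.BalabanUVNodes.N06DgDvdLegAtPinsT (dgDvd_pdgDvd_of_pinsT_all)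

variable {N : ℕ}

set_option maxRecDepth 8192 in
set_option maxHeartbeats 2400000 in -- two U8 layer passes (flat inside the prechain, real here) + eight supplier instantiations
/-- ★★★ **THE LEVEL-13 LETTERS, THE Δ⁽²⁾ LETTER DERIVED, AND THE U8 STATE LAYER, BUNDLED** (module docstring): `∃ MW aD θ₂` + the letters' and the state constants
with their signs such that, above `MW`: the seven letter families (regime `a₀`), the Δ⁽²⁾ letter (3.137) at `(Δ2 x)` with constant `θ₂`, rate `δ₂` (regime `aD ≤ a₀`),
and the four U8 state tuples at `(δK, δP)` (regime `aD`).
[cite: Balaban1985BackgroundPropagators, (3.137) p.423, Thm 3.3 (3.42)–(3.47) pp.397–399, Thms 3.12–3.13 (3.130)–(3.133) pp.421–422; Balaban1984PropagatorsII, Lemma 2.1 (2.60)–(2.61) p.234] -/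
theorem level13_d2_layer_of_pinsP_geo9Y_parQ [NeZero N] (θ : Stage3Params) (Mstar : ℕ) [∀ x : MemberY θ.d₆ θ.ℓ₆ θ.hd' θ.hL' θ.b₀ θ.b₁ Mstar, Fintype (geo9Y x).Site] [∀ x : MemberY θ.d₆ θ.ℓ₆ θ.hd' θ.hL' θ.b₀ θ.b₁ Mstar, DecidableRel (RelB x.toKIdx)] [∀ x : MemberY θ.d₆ θ.ℓ₆ θ.hd' θ.hL' θ.b₀ θ.b₁ Mstar, DecidableEq (geo9Y x).Site]
    {R₁ R₂ : RegFamY θ.d₆ θ.ℓ₆ θ.hd' θ.hL' θ.b₀ θ.b₁ Mstar (Matrix (Fin N) (Fin N) ℂ)} (H : MemberY θ.d₆ θ.ℓ₆ θ.hd' θ.hL' θ.b₀ θ.b₁ Mstar → Prop)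
    (bI : ∀ x : MemberY θ.d₆ θ.ℓ₆ θ.hd' θ.hL' θ.b₀ θ.b₁ Mstar, FBondY x.toKIdx → IBondY x.toKIdx)
    (hlev : ∀ (x : MemberY θ.d₆ θ.ℓ₆ θ.hd' θ.hL' θ.b₀ θ.b₁ Mstar) (f : FBondY x.toKIdx), lvl x.hN x.D x.hk (bI x f) = (blkV1 x.hN x.D f).1.1)
    (hβ1 : ∀ (x : MemberY θ.d₆ θ.ℓ₆ θ.hd' θ.hL' θ.b₀ θ.b₁ Mstar) (f : FBondY x.toKIdx), (geomT x.D).dist (β x.hN x.D x.hk (bI x f)) (blkV1 x.hN x.D f) ≤ 1)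
    (hbI0 : ∀ (x : MemberY θ.d₆ θ.ℓ₆ θ.hd' θ.hL' θ.b₀ θ.b₁ Mstar) (f : FBondY x.toKIdx), bI x f = bI x ⟨f.src, 0⟩) (hGR : MemOfFam (specialUnitaryUnits (Fin N)) R₁) (c : ℝ)
    -- print's class (3.35) at the letters (the certificate's `hRP1 … .2.1`, `c35Y_le_ten`)
    {c10 : ℝ} (hc10 : c10 ≤ 10)
    (hP : ∀ (x : MemberY θ.d₆ θ.ℓ₆ θ.hd' θ.hL' θ.b₀ θ.b₁ Mstar) (α₀ : ℝ) (U : (bg9YR (Matrix (Fin N) (Fin N) ℂ) (specialUnitaryUnits (Fin N)) R₁ R₂ x).Cfg), (bg9YR (Matrix (Fin N) (Fin N) ℂ) (specialUnitaryUnits (Fin N)) R₁ R₂ x).Reg335 c α₀ U → (bg9KP (Matrix (Fin N) (Fin N) ℂ) (specialUnitaryUnits (Fin N)) x.toKIdx).Reg335 c10 α₀ U)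
    -- ONE input regime for every letter below; the two margins σ τ of the U8 layer; the weights and the five input classes of record
    {M₀ a₀ : ℝ} (hM₀ : 0 ≤ M₀) (ha₀ : 0 < a₀) {σ τ : ℝ} (hσ : 0 < σ) (hτ : 0 < τ)
    (w13 : ℝ → ℝ) (hw13₀ : ∀ s, 0 ≤ w13 s) (hw13₁ : ∀ s, w13 s ≤ 1) (wX : ℝ → ℝ) (hwX₀ : ∀ s, 0 ≤ wX s) (hwX₁ : ∀ s, wX s ≤ 1)
    {s44 : ℝ} (hs440 : 0 < s44) (hs441 : s44 < 1) (hw1344 : 0 < w13 s44) (hwX44 : 0 < wX s44) (sch : ℝ → ℝ) (hsch0 : ∀ β', 0 ≤ β' → β' < 1 → 0 < sch β') (hsch1 : ∀ β', 0 ≤ β' → β' < 1 → sch β' < 1)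
    (hwsch : ∀ β', 0 ≤ β' → β' < 1 → 0 < w13 (sch β'))
    (bH13 : ∀ x : MemberY θ.d₆ θ.ℓ₆ θ.hd' θ.hL' θ.b₀ θ.b₁ Mstar, (bg9YR (Matrix (Fin N) (Fin N) ℂ) (specialUnitaryUnits (Fin N)) R₁ R₂ x).Cfg → BlockNorm (toB6 (geo9Y x) 1 (H x)) (XSK (TrIdx N) x.toKIdx → ℝ))
    (hbH13 : ∀ (x : MemberY θ.d₆ θ.ℓ₆ θ.hd' θ.hL' θ.b₀ θ.b₁ Mstar) (U : (bg9YR (Matrix (Fin N) (Fin N) ℂ) (specialUnitaryUnits (Fin N)) R₁ R₂ x).Cfg), bH13 x U = letI : Fintype (geo9K x.toKIdx).Site := (inferInstance : Fintype (geo9Y x).Site); bHZPG (κ := TrIdx N) x.toKIdx (trBasis N) (taxiS x.toKIdx (bg9YR (Matrix (Fin N) (Fin N) ℂ) (specialUnitaryUnits (Fin N)) R₁ R₂ x) (fun U => U) U) (R := (1 : ℝ)) (H := H x) w13 hw13₀ hw13₁)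
    (hκ13 : ∀ (x : MemberY θ.d₆ θ.ℓ₆ θ.hd' θ.hL' θ.b₀ θ.b₁ Mstar) (U : (bg9YR (Matrix (Fin N) (Fin N) ℂ) (specialUnitaryUnits (Fin N)) R₁ R₂ x).Cfg), (bH13 x U).κ ≤ 1 + CLip θ.d₆ θ.ℓ₆)
    (bXH : ∀ x : MemberY θ.d₆ θ.ℓ₆ θ.hd' θ.hL' θ.b₀ θ.b₁ Mstar, (bg9YR (Matrix (Fin N) (Fin N) ℂ) (specialUnitaryUnits (Fin N)) R₁ R₂ x).Cfg → BlockNorm (toB6 (geo9Y x) 1 (H x)) (XBK (TrIdx N) x.toKIdx → ℝ))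
    (hbXH : ∀ (x : MemberY θ.d₆ θ.ℓ₆ θ.hd' θ.hL' θ.b₀ θ.b₁ Mstar) (U : (bg9YR (Matrix (Fin N) (Fin N) ℂ) (specialUnitaryUnits (Fin N)) R₁ R₂ x).Cfg), bXH x U = letI : Fintype (geo9K x.toKIdx).Site := (inferInstance : Fintype (geo9Y x).Site); bHZKPG (κ := TrIdx N) x.toKIdx (trBasis N) (taxiB x.toKIdx (bg9YR (Matrix (Fin N) (Fin N) ℂ) (specialUnitaryUnits (Fin N)) R₁ R₂ x) (fun U => U) U) (R := (1 : ℝ)) (H := H x) wX hwX₀ hwX₁)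
    (bHXA : ∀ x : MemberY θ.d₆ θ.ℓ₆ θ.hd' θ.hL' θ.b₀ θ.b₁ Mstar, ℝ → BlockNorm (toB6 (geo9Y x) 1 (H x)) (XBK (TrIdx N) x.toKIdx → ℝ))
    (hbHXA : ∀ x : MemberY θ.d₆ θ.ℓ₆ θ.hd' θ.hL' θ.b₀ θ.b₁ Mstar, bHXA x = fun ε => letI : Fintype (geo9K x.toKIdx).Site := (inferInstance : Fintype (geo9Y x).Site); bHK x.toKIdx (bI x) ε)
    (bHXT : ∀ x : MemberY θ.d₆ θ.ℓ₆ θ.hd' θ.hL' θ.b₀ θ.b₁ Mstar, (bg9YR (Matrix (Fin N) (Fin N) ℂ) (specialUnitaryUnits (Fin N)) R₁ R₂ x).Cfg → ℝ → BlockNorm (toB6 (geo9Y x) 1 (H x)) (XSK (TrIdx N) x.toKIdx → ℝ))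
    (hbHXT : ∀ (x : MemberY θ.d₆ θ.ℓ₆ θ.hd' θ.hL' θ.b₀ θ.b₁ Mstar) (U : (bg9YR (Matrix (Fin N) (Fin N) ℂ) (specialUnitaryUnits (Fin N)) R₁ R₂ x).Cfg), bHXT x U = fun ε => letI : Fintype (geo9K x.toKIdx).Site := (inferInstance : Fintype (geo9Y x).Site); bHZPIfam (κ := TrIdx N) x.toKIdx (trBasis N) (taxiS x.toKIdx (bg9YR (Matrix (Fin N) (Fin N) ℂ) (specialUnitaryUnits (Fin N)) R₁ R₂ x) (fun U => U) U) (R := (1 : ℝ)) (H := H x) ε)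
    (bHXTA : ∀ x : MemberY θ.d₆ θ.ℓ₆ θ.hd' θ.hL' θ.b₀ θ.b₁ Mstar, (bg9YR (Matrix (Fin N) (Fin N) ℂ) (specialUnitaryUnits (Fin N)) R₁ R₂ x).Cfg → ℝ → BlockNorm (toB6 (geo9Y x) 1 (H x)) (XBK (TrIdx N) x.toKIdx → ℝ))
    (hbHXTA : ∀ (x : MemberY θ.d₆ θ.ℓ₆ θ.hd' θ.hL' θ.b₀ θ.b₁ Mstar) (U : (bg9YR (Matrix (Fin N) (Fin N) ℂ) (specialUnitaryUnits (Fin N)) R₁ R₂ x).Cfg), bHXTA x U = fun ε => letI : Fintype (geo9K x.toKIdx).Site := (inferInstance : Fintype (geo9Y x).Site); bHZKPIfam (κ := TrIdx N) x.toKIdx (trBasis N) (taxiB x.toKIdx (bg9YR (Matrix (Fin N) (Fin N) ℂ) (specialUnitaryUnits (Fin N)) R₁ R₂ x) (fun U => U) U) (R := (1 : ℝ)) (H := H x) ε)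
    -- the operator record of Theorems 3.12–3.13 and its pins; the Hölder probes; Theorem 3.10's record (rows 19) and its direction operators
    (𝔬12 : ∀ x : MemberY θ.d₆ θ.ℓ₆ θ.hd' θ.hL' θ.b₀ θ.b₁ Mstar, B9Thm312Whole.Ops (geo9Y x) (bg9YR (Matrix (Fin N) (Fin N) ℂ) (specialUnitaryUnits (Fin N)) R₁ R₂ x) (XBK (TrIdx N) x.toKIdx) (XBK (TrIdx N) x.toKIdx) (XHK (TrIdx N) x.toKIdx) (XSK (TrIdx N) x.toKIdx))
    (hblk12 : ∀ x : MemberY θ.d₆ θ.ℓ₆ θ.hd' θ.hL' θ.b₀ θ.b₁ Mstar, (𝔬12 x).blk = blkBK x.toKIdx (bI x)) (hblkW12 : ∀ x : MemberY θ.d₆ θ.ℓ₆ θ.hd' θ.hL' θ.b₀ θ.b₁ Mstar, (𝔬12 x).blkW = blkSK x.toKIdx (sIK x.toKIdx (bI x)))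
    (hblkY12 : ∀ x : MemberY θ.d₆ θ.ℓ₆ θ.hd' θ.hL' θ.b₀ θ.b₁ Mstar, (𝔬12 x).blkY = blkBK x.toKIdx (bI x)) (hblkZ12 : ∀ x : MemberY θ.d₆ θ.ℓ₆ θ.hd' θ.hL' θ.b₀ θ.b₁ Mstar, (𝔬12 x).blkZ = blkHK x.toKIdx)
    (O : ∀ x : MemberY θ.d₆ θ.ℓ₆ θ.hd' θ.hL' θ.b₀ θ.b₁ Mstar, BondOpY (Matrix (Fin N) (Fin N) ℂ) x.toKIdx)
    (hG0co12 : ∀ (x : MemberY θ.d₆ θ.ℓ₆ θ.hd' θ.hL' θ.b₀ θ.b₁ Mstar) (U : (bg9YR (Matrix (Fin N) (Fin N) ℂ) (specialUnitaryUnits (Fin N)) R₁ R₂ x).Cfg), (𝔬12 x).G0 U = GcoK x.toKIdx (trBasis N) (bg9YR (Matrix (Fin N) (Fin N) ℂ) (specialUnitaryUnits (Fin N)) R₁ R₂ x) (fun U => U) (O x) U)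
    (hDco12 : ∀ (x : MemberY θ.d₆ θ.ℓ₆ θ.hd' θ.hL' θ.b₀ θ.b₁ Mstar) (U : (bg9YR (Matrix (Fin N) (Fin N) ℂ) (specialUnitaryUnits (Fin N)) R₁ R₂ x).Cfg), (𝔬12 x).D U = DcoK x.toKIdx (trBasis N) (bg9YR (Matrix (Fin N) (Fin N) ℂ) (specialUnitaryUnits (Fin N)) R₁ R₂ x) (fun U => U) U)
    (hDsco12 : ∀ (x : MemberY θ.d₆ θ.ℓ₆ θ.hd' θ.hL' θ.b₀ θ.b₁ Mstar) (U : (bg9YR (Matrix (Fin N) (Fin N) ℂ) (specialUnitaryUnits (Fin N)) R₁ R₂ x).Cfg), (𝔬12 x).Dstar U = DscoK x.toKIdx (trBasis N) (bg9YR (Matrix (Fin N) (Fin N) ℂ) (specialUnitaryUnits (Fin N)) R₁ R₂ x) (fun U => U) U)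
    (𝔠 : C2Y N θ Mstar) (Δ2 : ∀ x : MemberY θ.d₆ θ.ℓ₆ θ.hd' θ.hL' θ.b₀ θ.b₁ Mstar, BondOpY (Matrix (Fin N) (Fin N) ℂ) x.toKIdx)
    (𝔮 : ∀ x : MemberY θ.d₆ θ.ℓ₆ θ.hd' θ.hL' θ.b₀ θ.b₁ Mstar, Node00.OpsYQLetter.QLetterY (Matrix (Fin N) (Fin N) ℂ) x.toKIdx) (𝔮s : ∀ x : MemberY θ.d₆ θ.ℓ₆ θ.hd' θ.hL' θ.b₀ θ.b₁ Mstar, Node00.OpsYQLetter.QsLetterY (Matrix (Fin N) (Fin N) ℂ) x.toKIdx)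
    (h𝔮 : ∀ (x : MemberY θ.d₆ θ.ℓ₆ θ.hd' θ.hL' θ.b₀ θ.b₁ Mstar) (U : CfgY (Matrix (Fin N) (Fin N) ℂ) x.toKIdx), 𝔮 x U = B9Eq3115KnitLetterY.QknitY x.toKIdx U)
    (h𝔮s : ∀ (x : MemberY θ.d₆ θ.ℓ₆ θ.hd' θ.hL' θ.b₀ θ.b₁ Mstar) (U : CfgY (Matrix (Fin N) (Fin N) ℂ) x.toKIdx), 𝔮s x U = Node00.OpsYQLetter.adjTrY (B9Eq3115KnitLetterY.QknitY x.toKIdx U))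
    (hadj : ∀ (x : MemberY θ.d₆ θ.ℓ₆ θ.hd' θ.hL' θ.b₀ θ.b₁ Mstar) (α₀ : ℝ) (U : (bg9YR (Matrix (Fin N) (Fin N) ℂ) (specialUnitaryUnits (Fin N)) R₁ R₂ x).Cfg), (bg9YR (Matrix (Fin N) (Fin N) ℂ) (specialUnitaryUnits (Fin N)) R₁ R₂ x).Reg335 c α₀ U → B9Thm311ReadingCoords.IsAdjTr (fun _ => (1 : ℝ)) (fun _ => (1 : ℝ)) (𝔮 x U) (𝔮s x U))
    (hΔ2def : ∀ x : MemberY θ.d₆ θ.ℓ₆ θ.hd' θ.hL' θ.b₀ θ.b₁ Mstar, Δ2 x = delta2OfQY (trDualMatY N) x.toKIdx (𝔮 x) (𝔮s x) (parKnitY x.toKIdx) (GpPhysY x.toKIdx (parKnitY x.toKIdx)) (𝔠 x).form)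
    (hTpico12 : ∀ (x : MemberY θ.d₆ θ.ℓ₆ θ.hd' θ.hL' θ.b₀ θ.b₁ Mstar) (U : (bg9YR (Matrix (Fin N) (Fin N) ℂ) (specialUnitaryUnits (Fin N)) R₁ R₂ x).Cfg), (𝔬12 x).Tpi U = TpicoK x.toKIdx (trBasis N) (bg9YR (Matrix (Fin N) (Fin N) ℂ) (specialUnitaryUnits (Fin N)) R₁ R₂ x) (fun U => U) (parKnitY x.toKIdx) (GpPhysY x.toKIdx (parKnitY x.toKIdx)) U)
    (hT2co12 : ∀ (x : MemberY θ.d₆ θ.ℓ₆ θ.hd' θ.hL' θ.b₀ θ.b₁ Mstar) (U : (bg9YR (Matrix (Fin N) (Fin N) ℂ) (specialUnitaryUnits (Fin N)) R₁ R₂ x).Cfg) , (𝔬12 x).T2 U = T2coK x.toKIdx (trBasis N) (bg9YR (Matrix (Fin N) (Fin N) ℂ) (specialUnitaryUnits (Fin N)) R₁ R₂ x) (fun U => U) (parKnitY x.toKIdx) (GpPhysY x.toKIdx (parKnitY x.toKIdx)) (Δ2 x) U)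
    (hDvco12 : ∀ (x : MemberY θ.d₆ θ.ℓ₆ θ.hd' θ.hL' θ.b₀ θ.b₁ Mstar) (U : (bg9YR (Matrix (Fin N) (Fin N) ℂ) (specialUnitaryUnits (Fin N)) R₁ R₂ x).Cfg), (𝔬12 x).Dv U = DvcoKH x.toKIdx (trBasis N) (bg9YR (Matrix (Fin N) (Fin N) ℂ) (specialUnitaryUnits (Fin N)) R₁ R₂ x) (fun U => U) U)
    (hDvsco12 : ∀ (x : MemberY θ.d₆ θ.ℓ₆ θ.hd' θ.hL' θ.b₀ θ.b₁ Mstar) (U : (bg9YR (Matrix (Fin N) (Fin N) ℂ) (specialUnitaryUnits (Fin N)) R₁ R₂ x).Cfg), (𝔬12 x).Dvstar U = DvscoKH x.toKIdx (trBasis N) (bg9YR (Matrix (Fin N) (Fin N) ℂ) (specialUnitaryUnits (Fin N)) R₁ R₂ x) (fun U => U) U)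
    (𝔭A : ∀ x : MemberY θ.d₆ θ.ℓ₆ θ.hd' θ.hL' θ.b₀ θ.b₁ Mstar, HolderProbes (geo9Y x) (bg9YR (Matrix (Fin N) (Fin N) ℂ) (specialUnitaryUnits (Fin N)) R₁ R₂ x) (XBK (TrIdx N) x.toKIdx) (XBK (TrIdx N) x.toKIdx) (PK (FBondY x.toKIdx) (Fin (θ.d₆ + 1)) (TrIdx N)) (PK (FBondY x.toKIdx) (Fin (θ.d₆ + 1)) (TrIdx N)))
    {parB : ∀ x : MemberY θ.d₆ θ.ℓ₆ θ.hd' θ.hL' θ.b₀ θ.b₁ Mstar, BondParY (Matrix (Fin N) (Fin N) ℂ) x.toKIdx} (hparB : ∀ x : MemberY θ.d₆ θ.ℓ₆ θ.hd' θ.hL' θ.b₀ θ.b₁ Mstar, parB x = parBY x.toKIdx)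
    (h𝔭A : ∀ x : MemberY θ.d₆ θ.ℓ₆ θ.hd' θ.hL' θ.b₀ θ.b₁ Mstar, 𝔭A x = holderProbesKA x.toKIdx (trBasis N) (bg9YR (Matrix (Fin N) (Fin N) ℂ) (specialUnitaryUnits (Fin N)) R₁ R₂ x) (fun U => U) (parB x) (bI x))
    {ιA AA : MemberY θ.d₆ θ.ℓ₆ θ.hd' θ.hL' θ.b₀ θ.b₁ Mstar → Type}
    (𝔬A : ∀ x : MemberY θ.d₆ θ.ℓ₆ θ.hd' θ.hL' θ.b₀ θ.b₁ Mstar, Ops310 (geo9Y x) (bg9YR (Matrix (Fin N) (Fin N) ℂ) (specialUnitaryUnits (Fin N)) R₁ R₂ x) (XBK (TrIdx N) x.toKIdx) (XBK (TrIdx N) x.toKIdx) (ιA x) (AA x))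
    (𝔡A : ∀ x : MemberY θ.d₆ θ.ℓ₆ θ.hd' θ.hL' θ.b₀ θ.b₁ Mstar, DirOps310 (𝔬A x) (Fin (θ.d₆ + 1)))
    (h𝔡Ad : ∀ (x : MemberY θ.d₆ θ.ℓ₆ θ.hd' θ.hL' θ.b₀ θ.b₁ Mstar) (U : (bg9YR (Matrix (Fin N) (Fin N) ℂ) (specialUnitaryUnits (Fin N)) R₁ R₂ x).Cfg), (𝔡A x).Dd U = fun μ => coordOpK (trBasis N) (fun _ : Fin (θ.d₆ + 1) => cdBₗ x.toKIdx U μ))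
    (h𝔡As : ∀ (x : MemberY θ.d₆ θ.ℓ₆ θ.hd' θ.hL' θ.b₀ θ.b₁ Mstar) (U : (bg9YR (Matrix (Fin N) (Fin N) ℂ) (specialUnitaryUnits (Fin N)) R₁ R₂ x).Cfg), (𝔡A x).Dsd U = fun μ => coordOpK (trBasis N) (fun _ : Fin (θ.d₆ + 1) => cdsBₗ x.toKIdx U μ))
    -- NUMERICS (implicit, read off the facts): the T-side letters' constants ∕ rates, the G₀ layer's, print's (3.32)-budget `ϑF`, rows 19's `Bi44 BZ BiY` at `δ44 δ45 δ45Y`,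
    -- the LEG margin `τR`, the second state layer's rates `δK δP` and the intermediate level-13 rate `δ13`
    {B₀ δ₀ CP δ49 tJ δB B43 δ43 tA δT δ₂ B44 δ44G B12₀ B12₂ δ12₀ BHG δ13 δK δP ϑF Bi44 δ44 δ45 δ45Y B0T B₃ : ℝ} {Bh12 Bi12 BZ BiY BhT BiT : ℝ → ℝ} {Bi2₁₂ Bi2T : ℝ → ℝ → ℝ}
    (hB₀ : 0 ≤ B₀) (hCP : 0 ≤ CP) (htJ : 0 ≤ tJ) (hB43 : 0 ≤ B43) (htA : 0 ≤ tA) (hB44 : 0 ≤ B44) (hB12₀ : 0 ≤ B12₀) (hB12₂ : 0 ≤ B12₂) (hBh12 : ∀ β', 0 ≤ β' → β' < 1 → 0 ≤ Bh12 β')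
    (hBi12 : ∀ ε, 0 < ε → ε ≤ 1 → 0 ≤ Bi12 ε) (hBHG : 0 ≤ BHG) (hwBhG : ∀ s, 0 < s → s < 1 → wX s * Bh12 s ≤ BHG)
    (hϑF : 0 ≤ ϑF) (hBi44 : 0 ≤ Bi44) (hBZ : ∀ β', 0 ≤ β' → β' < 1 → 0 ≤ BZ β') (hBiY : ∀ β', 0 ≤ β' → β' < 1 → 0 ≤ BiY β')
    (hBiT : ∀ ε, 0 < ε → ε ≤ 1 → 0 ≤ BiT ε) (hBi2T : ∀ ε β', 0 < ε → ε ≤ 1 → 0 ≤ β' → β' < 1 → 0 ≤ Bi2T ε β')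
    -- the (3.46) constant B₃ of the ∇G₀∇-letters at level 13 (the certificate's displayed `B12₃` with `hB12₃d ∕ hB12₃p` when δ13 = δ12₃)
    (hB₃ : 0 ≤ B₃) (hB3d : ((θ.d₆ : ℝ) + 1) * ((1 + CLip θ.d₆ θ.ℓ₆) * Bi44 * (CJG θ.d₆ θ.ℓ₆ (trBasis N) s44 (thetaL θ.d₆ θ.ℓ₆ ϑF) (w13 s44) (δ13 + 1 + 1 / 2 * (δ44 - δ13)) * (((θ.ℓ₆ + 1 : ℕ) : ℝ))) * rowConst261 (@geo9Y θ.d₆ θ.ℓ₆ θ.hd' θ.hL' θ.b₀ θ.b₁ Mstar) 1) ≤ B₃)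
    (hB3p : ((θ.d₆ : ℝ) + 1) * (1 * (((θ.d₆ : ℝ) + 1) * ((1 + CLip θ.d₆ θ.ℓ₆) * Bi44 * (CJG θ.d₆ θ.ℓ₆ (trBasis N) s44 (thetaL θ.d₆ θ.ℓ₆ ϑF) (w13 s44) (δ13 + 1 + 1 / 2 * (δ44 - δ13)) * (((θ.ℓ₆ + 1 : ℕ) : ℝ))) * rowConst261 (@geo9Y θ.d₆ θ.ℓ₆ θ.hd' θ.hL' θ.b₀ θ.b₁ Mstar) 1)) * rowConst261 (@geo9Y θ.d₆ θ.ℓ₆ θ.hd' θ.hL' θ.b₀ θ.b₁ Mstar) 1) ≤ B₃)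
    -- RATE BUDGET: the U8 budget of `hStateTuplesW_of_pinsP_geo9Y` at (δK, δP) with the level-13 slots read at δ13, and the [4] (2.60) transfer gaps of the level-13
    -- suppliers (`δ13 < δ12₀ ∕ δ44 ∕ δ45 ∕ δ45Y`); at the certificate's layer of record (δK, δP, δ13) = (δK12, δP, δ12₃)
    (hδK0 : 0 ≤ δK)
    (hr0 : δK + 3 * σ + 4 * τ ≤ δ₀) (hr49 : δK + 3 * σ + 4 * τ ≤ δ49) (hr2 : δK + 3 * σ + 4 * τ ≤ δ₂) (hr44 : δK + 3 * σ + 5 * τ ≤ δ44G) (hrB : δK + 3 * σ + 4 * τ ≤ δB)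
    (hr43 : δK + 2 * σ + τ ≤ δ43) (hrT : δK + τ + σ ≤ δT) (hK3d : δK + τ + σ ≤ δ13) (hKP : δK + τ + σ ≤ δP) (hP0 : δP + 2 * τ ≤ δ12₀) (hP3 : δP + σ + 2 * τ ≤ δ13)
    (h130 : δ13 < δ12₀) (h1344 : δ13 < δ44) (h1345 : δ13 < δ45) (h1345Y : δ13 < δ45Y)
    -- LETTERS (all on the regime (M₀, a₀)): the T-side letters of the U8 layer VERBATIM (`h31 h49 h43 h44G hta hBJ`; the Δ⁽²⁾ letter `hD2` is DERIVED inside)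
    (h31 : ∀ x : MemberY θ.d₆ θ.ℓ₆ θ.hd' θ.hL' θ.b₀ θ.b₁ Mstar, M₀ ≤ (geo9Y x).M → ∀ α₀ : ℝ, 0 < α₀ → (geo9Y x).M * α₀ ≤ a₀ → ∀ U : (bg9YR (Matrix (Fin N) (Fin N) ℂ) (specialUnitaryUnits (Fin N)) R₁ R₂ x).Cfg, (bg9YR (Matrix (Fin N) (Fin N) ℂ) (specialUnitaryUnits (Fin N)) R₁ R₂ x).Reg335 c α₀ U → Thm31GpMaj (g := geo9Y x) (blkSK x.toKIdx (sIK x.toKIdx (bI x))) (blkBK x.toKIdx (bI x)) (GcoS x.toKIdx (trBasis N) (bg9YR (Matrix (Fin N) (Fin N) ℂ) (specialUnitaryUnits (Fin N)) R₁ R₂ x) (fun U => U) (GpY x.toKIdx (parKnitY x.toKIdx)) U) (DvcoKH x.toKIdx (trBasis N) (bg9YR (Matrix (Fin N) (Fin N) ℂ) (specialUnitaryUnits (Fin N)) R₁ R₂ x) (fun U => U) U) (DvscoKH x.toKIdx (trBasis N) (bg9YR (Matrix (Fin N) (Fin N) ℂ) (specialUnitaryUnits (Fin N)) R₁ R₂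 x) (fun U => U) U) 1 (H x) B₀ δ₀)
    (h49 : ∀ x : MemberY θ.d₆ θ.ℓ₆ θ.hd' θ.hL' θ.b₀ θ.b₁ Mstar, M₀ ≤ (geo9Y x).M → ∀ α₀ : ℝ, 0 < α₀ → (geo9Y x).M * α₀ ≤ a₀ → ∀ U : (bg9YR (Matrix (Fin N) (Fin N) ℂ) (specialUnitaryUnits (Fin N)) R₁ R₂ x).Cfg, (bg9YR (Matrix (Fin N) (Fin N) ℂ) (specialUnitaryUnits (Fin N)) R₁ R₂ x).Reg335 c α₀ U → Proj349Maj (g := geo9Y x) (blkSK x.toKIdx (sIK x.toKIdx (bI x))) (blkBK x.toKIdx (bI x)) (PcoK x.toKIdx (trBasis N) (bg9YR (Matrix (Fin N) (Fin N) ℂ) (specialUnitaryUnits (Fin N)) R₁ R₂ x) (fun U => U) (parKnitY x.toKIdx) (GpY x.toKIdx (parKnitY x.toKIdx)) U) (DvcoKH x.toKIdx (trBasis N) (bg9YR (Matrix (Fin N) (Fin N) ℂ) (specialUnitaryUnits (Fin N)) R₁ R₂ x) (fun U => U) U) (DvscoKH x.toKIdx (trBasis N) (bg9YR (Matrix (Fin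 N) (Fin N) ℂ) (specialUnitaryUnits (Fin N)) R₁ R₂ x) (fun U => U) U) 1 (H x) CP δ49)
    (h43 : ∀ x : MemberY θ.d₆ θ.ℓ₆ θ.hd' θ.hL' θ.b₀ θ.b₁ Mstar, letI : Fintype (geo9K x.toKIdx).Site := (inferInstance : Fintype (geo9Y x).Site); M₀ ≤ (geo9Y x).M → ∀ α₀ : ℝ, 0 < α₀ → (geo9Y x).M * α₀ ≤ a₀ → ∀ U : (bg9YR (Matrix (Fin N) (Fin N) ℂ) (specialUnitaryUnits (Fin N)) R₁ R₂ x).Cfg, (bg9YR (Matrix (Fin N) (Fin N) ℂ) (specialUnitaryUnits (Fin N)) R₁ R₂ x).Reg335 c α₀ U → (bg9YR (Matrix (Fin N) (Fin N) ℂ) (specialUnitaryUnits (Fin N)) R₁ R₂ x).Reg336 c α₀ U → HasMaj (cNorm 1 (H x) (𝔬12 x).blk (fun y => (geo9Y_len_pos x y).le) 0) (bH13 x U) (GcoS x.toKIdx (trBasis N) (bg9YR (Matrix (Fin N) (Fin N) ℂ) (specialUnitaryUnits (Fin N)) R₁ R₂ x) (fun U => U) (GpY x.toKIdx (parKnitY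 x.toKIdx)) U ∘ₗ DvscoKH x.toKIdx (trBasis N) (bg9YR (Matrix (Fin N) (Fin N) ℂ) (specialUnitaryUnits (Fin N)) R₁ R₂ x) (fun U => U) U) (fun a a' => B43 * Real.exp (-(δ43 * (geo9Y x).dist a a'))))
    (h44G : ∀ x : MemberY θ.d₆ θ.ℓ₆ θ.hd' θ.hL' θ.b₀ θ.b₁ Mstar, letI : Fintype (geo9K x.toKIdx).Site := (inferInstance : Fintype (geo9Y x).Site); M₀ ≤ (geo9Y x).M → ∀ α₀ : ℝ, 0 < α₀ → (geo9Y x).M * α₀ ≤ a₀ → ∀ U : (bg9YR (Matrix (Fin N) (Fin N) ℂ) (specialUnitaryUnits (Fin N)) R₁ R₂ x).Cfg, (bg9YR (Matrix (Fin N) (Fin N) ℂ) (specialUnitaryUnits (Fin N)) R₁ R₂ x).Reg335 c α₀ U → (bg9YR (Matrix (Fin N) (Fin N) ℂ) (specialUnitaryUnits (Fin N)) R₁ R₂ x).Reg336 c α₀ U → HasMaj (bHZKP (κ := TrIdx N) x.toKIdx (trBasis N) (taxiB x.toKIdx (bg9YR (Matrix (Fin N) (Fin N) ℂ) (specialUnitaryUnits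 (Fin N)) R₁ R₂ x) (fun U => U) U) (R := (1 : ℝ)) (H := H x) hs440.le hs441.le) (cNorm 1 (H x) (𝔬12 x).blk (fun y => (geo9Y_len_pos x y).le) 1) ((𝔬12 x).Dv U ∘ₗ GcoS x.toKIdx (trBasis N) (bg9YR (Matrix (Fin N) (Fin N) ℂ) (specialUnitaryUnits (Fin N)) R₁ R₂ x) (fun U => U) (GpY x.toKIdx (parKnitY x.toKIdx)) U ∘ₗ (𝔬12 x).Dvstar U) (fun a b => B44 * Real.exp (-(δ44G * (geo9Y x).dist a b))))
    (hta : ∀ x : MemberY θ.d₆ θ.ℓ₆ θ.hd' θ.hL' θ.b₀ θ.b₁ Mstar, M₀ ≤ (geo9Y x).M → ∀ α₀ : ℝ, 0 < α₀ → (geo9Y x).M * α₀ ≤ a₀ → ∀ U : (bg9YR (Matrix (Fin N) (Fin N) ℂ) (specialUnitaryUnits (Fin N)) R₁ R₂ x).Cfg, (bg9YR (Matrix (Fin N) (Fin N) ℂ) (specialUnitaryUnits (Fin N)) R₁ R₂ x).Reg335 c α₀ U → (bg9YR (Matrix (Fin N) (Fin N) ℂ) (specialUnitaryUnits (Fin N))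 R₁ R₂ x).Reg336 c α₀ U → HasMaj (cNorm 1 (H x) (𝔬12 x).blk (fun y => (geo9Y_len_pos x y).le) 2) (cNorm 1 (H x) (𝔬12 x).blk (fun y => (geo9Y_len_pos x y).le) 0) (TaLcoK x.toKIdx (trBasis N) (bg9YR (Matrix (Fin N) (Fin N) ℂ) (specialUnitaryUnits (Fin N)) R₁ R₂ x) (fun U => U) (parKnitY x.toKIdx) (GpPhysY x.toKIdx (parKnitY x.toKIdx)) U) (fun a a' => tA * ((geo9Y x).M * α₀) * Real.exp (-(δT * (geo9Y x).dist a a'))))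
    (hBJ : ∀ x : MemberY θ.d₆ θ.ℓ₆ θ.hd' θ.hL' θ.b₀ θ.b₁ Mstar, M₀ ≤ (geo9Y x).M → ∀ α₀ : ℝ, 0 < α₀ → (geo9Y x).M * α₀ ≤ a₀ → ∀ U : (bg9YR (Matrix (Fin N) (Fin N) ℂ) (specialUnitaryUnits (Fin N)) R₁ R₂ x).Cfg, (bg9YR (Matrix (Fin N) (Fin N) ℂ) (specialUnitaryUnits (Fin N)) R₁ R₂ x).Reg335 c α₀ U → (bg9YR (Matrix (Fin N) (Fin N) ℂ) (specialUnitaryUnits (Fin N)) R₁ R₂ x).Reg336 c α₀ U → CurrentMaj (𝔬12 x).blkW (𝔬12 x).blk (BcoKH x.toKIdx (trBasis N) (bg9YR (Matrix (Fin N) (Fin N) ℂ) (specialUnitaryUnits (Fin N)) R₁ R₂ x) (fun U => U) U) (BdcoKH x.toKIdx (trBasis N) (bg9YR (Matrix (Fin N) (Fin N) ℂ) (specialUnitaryUnits (Fin N)) R₁ R₂ x) (fun U => U) U) 1 (H x) (tJ * ((geo9Y x).M * α₀)) δB)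
    -- the G₀ layer (`g0_layer_of_thm310_coreDir₃USP`): Thm 3.3 for G₀ (blocks ∕ directions ∕ adjoint directions ∕ mixed L²), the (3.39)-hom letter ∇_UG₀, the identities; and Thm 3.3 for G₀ at
    -- the TRANSPORTED bond class (`thm33G0DirT_of_local3107`)
    (hG0 : ∀ x : MemberY θ.d₆ θ.ℓ₆ θ.hd' θ.hL' θ.b₀ θ.b₁ Mstar, M₀ ≤ (geo9Y x).M → ∀ α₀ : ℝ, 0 < α₀ → (geo9Y x).M * α₀ ≤ a₀ → ∀ U : (bg9YR (Matrix (Fin N) (Fin N) ℂ) (specialUnitaryUnits (Fin N)) R₁ R₂ x).Cfg, (bg9YR (Matrix (Fin N) (Fin N) ℂ) (specialUnitaryUnits (Fin N)) R₁ R₂ x).Reg335 c α₀ U → (bg9YR (Matrix (Fin N) (Fin N) ℂ) (specialUnitaryUnits (Fin N)) R₁ R₂ x).Reg336 c α₀ U → Thm33G0 (𝔬12 x) 1 (H x) B12₀ δ12₀ U)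
    (hG0D : ∀ x : MemberY θ.d₆ θ.ℓ₆ θ.hd' θ.hL' θ.b₀ θ.b₁ Mstar, M₀ ≤ (geo9Y x).M → ∀ α₀ : ℝ, 0 < α₀ → (geo9Y x).M * α₀ ≤ a₀ → ∀ U : (bg9YR (Matrix (Fin N) (Fin N) ℂ) (specialUnitaryUnits (Fin N)) R₁ R₂ x).Cfg, (bg9YR (Matrix (Fin N) (Fin N) ℂ) (specialUnitaryUnits (Fin N)) R₁ R₂ x).Reg335 c α₀ U → (bg9YR (Matrix (Fin N) (Fin N) ℂ) (specialUnitaryUnits (Fin N)) R₁ R₂ x).Reg336 c α₀ U → Thm33G0Dir (𝔬12 x) (𝔭A x) (𝔡A x).Dd (𝔡A x).Dsd 1 (H x) (bHXA x) B12₀ Bh12 Bi12 Bi2₁₂ δ12₀ U)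
    (hG0DR : ∀ x : MemberY θ.d₆ θ.ℓ₆ θ.hd' θ.hL' θ.b₀ θ.b₁ Mstar, M₀ ≤ (geo9Y x).M → ∀ α₀ : ℝ, 0 < α₀ → (geo9Y x).M * α₀ ≤ a₀ → ∀ U : (bg9YR (Matrix (Fin N) (Fin N) ℂ) (specialUnitaryUnits (Fin N)) R₁ R₂ x).Cfg, (bg9YR (Matrix (Fin N) (Fin N) ℂ) (specialUnitaryUnits (Fin N)) R₁ R₂ x).Reg335 c α₀ U → (bg9YR (Matrix (Fin N) (Fin N) ℂ) (specialUnitaryUnits (Fin N)) R₁ R₂ x).Reg336 c α₀ U → Thm33G0DirR (𝔬12 x) (𝔡A x).Dsd 1 (H x) B12₀ δ12₀ U)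
    (hG0L2M : ∀ x : MemberY θ.d₆ θ.ℓ₆ θ.hd' θ.hL' θ.b₀ θ.b₁ Mstar, M₀ ≤ (geo9Y x).M → ∀ α₀ : ℝ, 0 < α₀ → (geo9Y x).M * α₀ ≤ a₀ → ∀ U : (bg9YR (Matrix (Fin N) (Fin N) ℂ) (specialUnitaryUnits (Fin N)) R₁ R₂ x).Cfg, (bg9YR (Matrix (Fin N) (Fin N) ℂ) (specialUnitaryUnits (Fin N)) R₁ R₂ x).Reg335 c α₀ U → (bg9YR (Matrix (Fin N) (Fin N) ℂ) (specialUnitaryUnits (Fin N)) R₁ R₂ x).Reg336 c α₀ U → Thm33G0L2M (𝔬12 x) (𝔡A x).Dd (𝔡A x).Dsd 1 (H x) B12₂ δ12₀ U)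
    (he1 : ∀ x : MemberY θ.d₆ θ.ℓ₆ θ.hd' θ.hL' θ.b₀ θ.b₁ Mstar, M₀ ≤ (geo9Y x).M → ∀ α₀ : ℝ, 0 < α₀ → (geo9Y x).M * α₀ ≤ a₀ → ∀ U : (bg9YR (Matrix (Fin N) (Fin N) ℂ) (specialUnitaryUnits (Fin N)) R₁ R₂ x).Cfg, (bg9YR (Matrix (Fin N) (Fin N) ℂ) (specialUnitaryUnits (Fin N)) R₁ R₂ x).Reg335 c α₀ U → (bg9YR (Matrix (Fin N) (Fin N) ℂ) (specialUnitaryUnits (Fin N)) R₁ R₂ x).Reg336 c α₀ U → HasMajorantHom (g := toB6 (geo9Y x) 1 (H x)) (𝔬12 x).blk (𝔬12 x).blkY ((𝔬12 x).D U ∘ₗ (𝔬12 x).G0 U) (fun (a b : (geo9Y x).Site) => B12₀ * (geo9Y x).len a * Real.exp (-(δ12₀ * (geo9Y x).dist a b))))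
    (hG0CT : ∀ x : MemberY θ.d₆ θ.ℓ₆ θ.hd' θ.hL' θ.b₀ θ.b₁ Mstar, M₀ ≤ (geo9Y x).M → ∀ α₀ : ℝ, 0 < α₀ → (geo9Y x).M * α₀ ≤ a₀ → ∀ U : (bg9YR (Matrix (Fin N) (Fin N) ℂ) (specialUnitaryUnits (Fin N)) R₁ R₂ x).Cfg, (bg9YR (Matrix (Fin N) (Fin N) ℂ) (specialUnitaryUnits (Fin N)) R₁ R₂ x).Reg335 c α₀ U → (bg9YR (Matrix (Fin N) (Fin N) ℂ) (specialUnitaryUnits (Fin N)) R₁ R₂ x).Reg336 c α₀ U → Thm33G0Dir (𝔬12 x) (𝔭A x) (𝔡A x).Dd (𝔡A x).Dsd 1 (H x) (bHXTA x U) B0T BhT BiT Bi2T δ12₀ U)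
    -- print's (3.32) plaquette budget and rows 19's G₀-twin letters `h45X h44m h45Y` (dag-n06-c `h44m_h45X_h45Y_of_local3107`), inputs of the (3.46) legs `hXd ∕ dgDH ∕ pYDH`
    (hF : ∀ x : MemberY θ.d₆ θ.ℓ₆ θ.hd' θ.hL' θ.b₀ θ.b₁ Mstar, letI : Fintype (geo9K x.toKIdx).Site := (inferInstance : Fintype (geo9Y x).Site); M₀ ≤ (geo9Y x).M → ∀ α₀ : ℝ, 0 < α₀ → (geo9Y x).M * α₀ ≤ a₀ → ∀ U : (bg9YR (Matrix (Fin N) (Fin N) ℂ) (specialUnitaryUnits (Fin N)) R₁ R₂ x).Cfg, (bg9YR (Matrix (Fin N) (Fin N) ℂ) (specialUnitaryUnits (Fin N)) R₁ R₂ x).Reg335 c α₀ U → (bg9YR (Matrix (Fin N) (Fin N) ℂ) (specialUnitaryUnits (Fin N)) R₁ R₂ x).Reg336 c α₀ U → ∀ (y : Site (PV θ.d₆ θ.ℓ₆ x.m x.K θ.hd' θ.hL') 0) (μ' ν' : Fin (θ.d₆ + 1)), ‖(plaqV U y μ' ν' : Matrix (Fin N) (Fin N) ℂ) - 1‖ ≤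 ϑF * (((((θ.ℓ₆ + 1 : ℕ) : ℝ)) ^ levY x.toKIdx (chartY x.toKIdx y))⁻¹))
    (h45X : ∀ x : MemberY θ.d₆ θ.ℓ₆ θ.hd' θ.hL' θ.b₀ θ.b₁ Mstar, letI : Fintype (geo9K x.toKIdx).Site := (inferInstance : Fintype (geo9Y x).Site); M₀ ≤ (geo9Y x).M → ∀ α₀ : ℝ, 0 < α₀ → (geo9Y x).M * α₀ ≤ a₀ → ∀ U : (bg9YR (Matrix (Fin N) (Fin N) ℂ) (specialUnitaryUnits (Fin N)) R₁ R₂ x).Cfg, (bg9YR (Matrix (Fin N) (Fin N) ℂ) (specialUnitaryUnits (Fin N)) R₁ R₂ x).Reg335 c α₀ U → (bg9YR (Matrix (Fin N) (Fin N) ℂ) (specialUnitaryUnits (Fin N)) R₁ R₂ x).Reg336 c α₀ U → ∀ (ν μ : Fin (θ.d₆ + 1)) (β' : ℝ) (h0 : 0 ≤ β') (h1 : β' < 1), HasMaj (bHZKP (κ := TrIdx N) x.toKIdx (trBasis N) (taxiB x.toKIdx (bg9YR (Matrix (Fin N) (Fin N) ℂ) (specialUnitaryUnits (Fin N)) R₁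 R₂ x) (fun U => U) U) (R := (1 : ℝ)) (H := H x) (hsch0 β' h0 h1).le (hsch1 β' h0 h1).le) (cNormR 1 (H x) (𝔭A x).blkPX (fun y => (geo9Y_len_pos x y).le) (β' - 1)) ((𝔭A x).ΦX U β' ∘ₗ ((𝔡A x).Dd U ν ∘ₗ ((𝔬12 x).G0 U ∘ₗ (𝔡A x).Dsd U μ))) (fun a a' => BZ β' * Real.exp (-(δ45 * (geo9Y x).dist a a'))))
    (h44m : ∀ x : MemberY θ.d₆ θ.ℓ₆ θ.hd' θ.hL' θ.b₀ θ.b₁ Mstar, letI : Fintype (geo9K x.toKIdx).Site := (inferInstance : Fintype (geo9Y x).Site); M₀ ≤ (geo9Y x).M → ∀ α₀ : ℝ, 0 < α₀ → (geo9Y x).M * α₀ ≤ a₀ → ∀ U : (bg9YR (Matrix (Fin N) (Fin N) ℂ) (specialUnitaryUnits (Fin N)) R₁ R₂ x).Cfg, (bg9YR (Matrix (Fin N) (Fin N) ℂ) (specialUnitaryUnits (Fin N)) R₁ R₂ x).Reg335 c α₀ U → (bg9YR (Matrix (Fin N) (Fin N) ℂ) (specialUnitaryUnits (Fin N)) R₁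 R₂ x).Reg336 c α₀ U → ∀ ν μ : Fin (θ.d₆ + 1), HasMaj (bHZKP (κ := TrIdx N) x.toKIdx (trBasis N) (taxiB x.toKIdx (bg9YR (Matrix (Fin N) (Fin N) ℂ) (specialUnitaryUnits (Fin N)) R₁ R₂ x) (fun U => U) U) (R := (1 : ℝ)) (H := H x) hs440.le hs441.le) (cNorm 1 (H x) (𝔬12 x).blk (fun y => (geo9Y_len_pos x y).le) 1) ((𝔡A x).Dd U ν ∘ₗ ((𝔬12 x).G0 U ∘ₗ (𝔡A x).Dsd U μ)) (fun a a' => Bi44 * Real.exp (-(δ44 * (geo9Y x).dist a a'))))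
    (h45Y : ∀ x : MemberY θ.d₆ θ.ℓ₆ θ.hd' θ.hL' θ.b₀ θ.b₁ Mstar, letI : Fintype (geo9K x.toKIdx).Site := (inferInstance : Fintype (geo9Y x).Site); M₀ ≤ (geo9Y x).M → ∀ α₀ : ℝ, 0 < α₀ → (geo9Y x).M * α₀ ≤ a₀ → ∀ U : (bg9YR (Matrix (Fin N) (Fin N) ℂ) (specialUnitaryUnits (Fin N)) R₁ R₂ x).Cfg, (bg9YR (Matrix (Fin N) (Fin N) ℂ) (specialUnitaryUnits (Fin N)) R₁ R₂ x).Reg335 c α₀ U → (bg9YR (Matrix (Fin N) (Fin N) ℂ) (specialUnitaryUnits (Fin N)) R₁ R₂ x).Reg336 c α₀ U → ∀ (β' : ℝ) (h0 : 0 ≤ β') (h1 : β' < 1) (μ : Fin (θ.d₆ + 1)), HasMaj (bHZKP (κ := TrIdx N) x.toKIdx (trBasis N) (taxiB x.toKIdx (bg9YR (Matrix (Fin N) (Fin N) ℂ) (specialUnitaryUnits (Fin N)) R₁ R₂ x) (fun U => U) U) (R := (1 : ℝ)) (H := H x) (hsch0 β' h0 h1).le (hsch1 β' h0 h1).le) (cNormR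 1 (H x) (𝔭A x).blkPY (fun y => (geo9Y_len_pos x y).le) (β' - 1)) ((𝔭A x).ΦY U β' ∘ₗ ((𝔬12 x).D U ∘ₗ ((𝔬12 x).G0 U ∘ₗ (𝔡A x).Dsd U μ))) (fun a a' => BiY β' * Real.exp (-(δ45Y * (geo9Y x).dist a a'))))
    -- P-D2 (cut 1, dag-n06-l `d2sup_prechain_v2_of_pins` ✓p764766): the Δ⁽²⁾-free identities and G₀'s positivity ∕ symmetry, the T_π block-L² letter, the G_D road's rates, the Sect.-D pins of S₀ ∕ G ∕ C, print's (3.36) class, [5] (149)'s C⁽²⁾ form letter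
    (hinvG0 : ∀ x : MemberY θ.d₆ θ.ℓ₆ θ.hd' θ.hL' θ.b₀ θ.b₁ Mstar, M₀ ≤ (geo9Y x).M → ∀ α₀ : ℝ, 0 < α₀ → (geo9Y x).M * α₀ ≤ a₀ → ∀ U : (bg9YR (Matrix (Fin N) (Fin N) ℂ) (specialUnitaryUnits (Fin N)) R₁ R₂ x).Cfg, (bg9YR (Matrix (Fin N) (Fin N) ℂ) (specialUnitaryUnits (Fin N)) R₁ R₂ x).Reg335 c α₀ U → (bg9YR (Matrix (Fin N) (Fin N) ℂ) (specialUnitaryUnits (Fin N)) R₁ R₂ x).Reg336 c α₀ U → (𝔬12 x).G0 U * (𝔬12 x).S0 U = 1)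
    (hpos12 : ∀ x : MemberY θ.d₆ θ.ℓ₆ θ.hd' θ.hL' θ.b₀ θ.b₁ Mstar, M₀ ≤ (geo9Y x).M → ∀ α₀ : ℝ, 0 < α₀ → (geo9Y x).M * α₀ ≤ a₀ → ∀ U : (bg9YR (Matrix (Fin N) (Fin N) ℂ) (specialUnitaryUnits (Fin N)) R₁ R₂ x).Cfg, (bg9YR (Matrix (Fin N) (Fin N) ℂ) (specialUnitaryUnits (Fin N)) R₁ R₂ x).Reg335 c α₀ U → (bg9YR (Matrix (Fin N) (Fin N) ℂ) (specialUnitaryUnits (Fin N)) R₁ R₂ x).Reg336 c α₀ U → B9Thm312Whole.PosDefEnd ((𝔬12 x).S0 U))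
    (hsym12 : ∀ x : MemberY θ.d₆ θ.ℓ₆ θ.hd' θ.hL' θ.b₀ θ.b₁ Mstar, M₀ ≤ (geo9Y x).M → ∀ α₀ : ℝ, 0 < α₀ → (geo9Y x).M * α₀ ≤ a₀ → ∀ U : (bg9YR (Matrix (Fin N) (Fin N) ℂ) (specialUnitaryUnits (Fin N)) R₁ R₂ x).Cfg, (bg9YR (Matrix (Fin N) (Fin N) ℂ) (specialUnitaryUnits (Fin N)) R₁ R₂ x).Reg335 c α₀ U → (bg9YR (Matrix (Fin N) (Fin N) ℂ) (specialUnitaryUnits (Fin N)) R₁ R₂ x).Reg336 c α₀ U → B9Thm37Glue.IsTransposePair ((𝔬12 x).G0 U) ((𝔬12 x).G0 U))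
    {BL0 δL0 t2L δT σF : ℝ} (hBL0 : 0 ≤ BL0) (ht2L : 0 ≤ t2L) (hσF : 0 < σF) (hσF0 : σF ≤ δL0) (hσFT : σF ≤ δT)
    (hl0 : ∀ x : MemberY θ.d₆ θ.ℓ₆ θ.hd' θ.hL' θ.b₀ θ.b₁ Mstar, M₀ ≤ (geo9Y x).M → ∀ α₀ : ℝ, 0 < α₀ → (geo9Y x).M * α₀ ≤ a₀ → ∀ U : (bg9YR (Matrix (Fin N) (Fin N) ℂ) (specialUnitaryUnits (Fin N)) R₁ R₂ x).Cfg, (bg9YR (Matrix (Fin N) (Fin N) ℂ) (specialUnitaryUnits (Fin N)) R₁ R₂ x).Reg335 c α₀ U → (bg9YR (Matrix (Fin N) (Fin N) ℂ) (specialUnitaryUnits (Fin N)) R₁ R₂ x).Reg336 c α₀ U → B9SectDL2Decay.BlockBd (g := toB6 (geo9Y x) 1 (H x)) (𝔬12 x).blk (𝔬12 x).blk ((𝔬12 x).G0 U) (fun (y y' : (geo9Y x).Site) => BL0 * (geo9Y x).len y * (geo9Y x).len y' * Real.exp (-(δL0 * (geo9Y x).dist y y'))))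
    (htpi : ∀ x : MemberY θ.d₆ θ.ℓ₆ θ.hd' θ.hL' θ.b₀ θ.b₁ Mstar, M₀ ≤ (geo9Y x).M → ∀ α₀ : ℝ, 0 < α₀ → (geo9Y x).M * α₀ ≤ a₀ → ∀ U : (bg9YR (Matrix (Fin N) (Fin N) ℂ) (specialUnitaryUnits (Fin N)) R₁ R₂ x).Cfg, (bg9YR (Matrix (Fin N) (Fin N) ℂ) (specialUnitaryUnits (Fin N)) R₁ R₂ x).Reg335 c α₀ U → (bg9YR (Matrix (Fin N) (Fin N) ℂ) (specialUnitaryUnits (Fin N)) R₁ R₂ x).Reg336 c α₀ U → B9SectDL2Decay.BlockBd (g := toB6 (geo9Y x) 1 (H x)) (𝔬12 x).blk (𝔬12 x).blk ((𝔬12 x).Tpi U) (fun (y y' : (geo9Y x).Site) => t2L * ((geo9Y x).M * α₀) * ((geo9Y x).len y)⁻¹ * ((geo9Y x).len y')⁻¹ * Real.exp (-(δT * (geo9Y x).dist y y'))))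
    {ρG : ℝ} (hρG : 0 < ρG) (hρGP : ρG + σ ≤ δP) (hρGK : ρG + 2 * σ ≤ δK)
    (hS0co12 : ∀ (x : MemberY θ.d₆ θ.ℓ₆ θ.hd' θ.hL' θ.b₀ θ.b₁ Mstar) (U : (bg9YR (Matrix (Fin N) (Fin N) ℂ) (specialUnitaryUnits (Fin N)) R₁ R₂ x).Cfg), (𝔬12 x).S0 U = S0coKq x.toKIdx (trBasis N) (bg9YR (Matrix (Fin N) (Fin N) ℂ) (specialUnitaryUnits (Fin N)) R₁ R₂ x) (fun U => U) (𝔮 x) (𝔮s x) (parKnitY x.toKIdx) (GpPhysY x.toKIdx (parKnitY x.toKIdx)) U)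
    (hGco12 : ∀ (x : MemberY θ.d₆ θ.ℓ₆ θ.hd' θ.hL' θ.b₀ θ.b₁ Mstar) (U : (bg9YR (Matrix (Fin N) (Fin N) ℂ) (specialUnitaryUnits (Fin N)) R₁ R₂ x).Cfg), (𝔬12 x).G U = GcoK x.toKIdx (trBasis N) (bg9YR (Matrix (Fin N) (Fin N) ℂ) (specialUnitaryUnits (Fin N)) R₁ R₂ x) (fun U => U) (GDQY x.toKIdx (𝔮 x) (𝔮s x) (parKnitY x.toKIdx) (GpPhysY x.toKIdx (parKnitY x.toKIdx))) U)
    (hCco12 : ∀ (x : MemberY θ.d₆ θ.ℓ₆ θ.hd' θ.hL' θ.b₀ θ.b₁ Mstar) (U : (bg9YR (Matrix (Fin N) (Fin N) ℂ) (specialUnitaryUnits (Fin N)) R₁ R₂ x).Cfg), (𝔬12 x).C U = CcoKq x.toKIdx (trBasis N) (bg9YR (Matrix (Fin N) (Fin N) ℂ) (specialUnitaryUnits (Fin N)) R₁ R₂ x) (fun U => U) (𝔮 x) (𝔮s x) (parKnitY x.toKIdx) (GpPhysY x.toKIdx (parKnitY x.toKIdx)) U)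
    (hRP2 : ∀ (x : MemberY θ.d₆ θ.ℓ₆ θ.hd' θ.hL' θ.b₀ θ.b₁ Mstar) (α₀ : ℝ) (U : (bg9YR (Matrix (Fin N) (Fin N) ℂ) (specialUnitaryUnits (Fin N)) R₁ R₂ x).Cfg), (bg9YR (Matrix (Fin N) (Fin N) ℂ) (specialUnitaryUnits (Fin N)) R₁ R₂ x).Reg336 c α₀ U → 0 ≤ α₀ ∧ (bg9YP (Matrix (Fin N) (Fin N) ℂ) (specialUnitaryUnits (Fin N)) x).Reg336 c35Y α₀ U)
    {κC δC2 : ℝ} (hκC : 0 ≤ κC) (hgap : δ₂ < δC2)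
    -- cut 1 of LOCATED-D2-CYCLE-2 (prechain v2): `O` IS G_A's inverse, print's (3.35)∕(3.36) classes from the record's, (Thm 3.11) Δ_A's positivity on its own regime, the neighbour count
    (Δ : ∀ x : MemberY θ.d₆ θ.ℓ₆ θ.hd' θ.hL' θ.b₀ θ.b₁ Mstar, CfgY (Matrix (Fin N) (Fin N) ℂ) x.toKIdx → ((FBondY x.toKIdx → Matrix (Fin N) (Fin N) ℂ) →ₗ[ℂ] (FBondY x.toKIdx → Matrix (Fin N) (Fin N) ℂ))) (hΔdef : ∀ (x : MemberY θ.d₆ θ.ℓ₆ θ.hd' θ.hL' θ.b₀ θ.b₁ Mstar) (U : CfgY (Matrix (Fin N) (Fin N) ℂ) x.toKIdx), Δ x U = deltaAQY x.toKIdx (𝔮 x) (𝔮s x) (parKnitY x.toKIdx) (GpY x.toKIdx (parKnitY x.toKIdx)) U)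
    (hO : ∀ (x : MemberY θ.d₆ θ.ℓ₆ θ.hd' θ.hL' θ.b₀ θ.b₁ Mstar) (U : CfgY (Matrix (Fin N) (Fin N) ℂ) x.toKIdx), O x U = Ring.inverse (Δ x U))
    (a311 M311 : ℝ) (ha311 : 0 < a311) (hM311 : 0 < M311)
    {mN : ℕ} (hnbr : ∀ (x : MemberY θ.d₆ θ.ℓ₆ θ.hd' θ.hL' θ.b₀ θ.b₁ Mstar) (y : (geo9Y x).Site), (nbr (geo9Y x) ((θ.ℓ₆ : ℝ) + 4) y).card ≤ mN)
    (hC2 : ∀ x : MemberY θ.d₆ θ.ℓ₆ θ.hd' θ.hL' θ.b₀ θ.b₁ Mstar, M₀ ≤ (geo9Y x).M → ∀ α₀ : ℝ, 0 < α₀ → (geo9Y x).M * α₀ ≤ a₀ → ∀ U : (bg9YR (Matrix (Fin N) (Fin N) ℂ) (specialUnitaryUnits (Fin N)) R₁ R₂ x).Cfg, (bg9YR (Matrix (Fin N) (Fin N) ℂ) (specialUnitaryUnits (Fin N)) R₁ R₂ x).Reg335 c α₀ U → (bg9YR (Matrix (Fin N) (Fin N) ℂ) (specialUnitaryUnits (Fin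 N)) R₁ R₂ x).Reg336 c α₀ U → C2FormMaj x.toKIdx (g := geo9Y x) (bI x) (fun c => c) (𝔠 x).form U κC δC2 (fun c => (geo9Y x).len c * (((((θ.ℓ₆ + 1 : ℕ) : ℝ) ^ (θ.d₆ + 1)) ^ lvl x.hN x.D x.hk c)⁻¹)))
    -- [CASCADE-K «KD″»] THE CLASS LETTER OF `Q⋆(U)` DISPLAYED (dag-n06-l's law `hqsK`; feeds the G₀Q⋆ transfer letters `…_of_laws`)
    (BQ δQ : ℝ) (hBQ : 0 ≤ BQ) (hδQ1 : δ12₀ + 1 ≤ δQ)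
    (hqsK : ∀ x : MemberY θ.d₆ θ.ℓ₆ θ.hd' θ.hL' θ.b₀ θ.b₁ Mstar, M₀ ≤ (geo9Y x).M → ∀ α₀ : ℝ, 0 < α₀ → (geo9Y x).M * α₀ ≤ a₀ → ∀ U : (bg9YR (Matrix (Fin N) (Fin N) ℂ) (specialUnitaryUnits (Fin N)) R₁ R₂ x).Cfg, (bg9YR (Matrix (Fin N) (Fin N) ℂ) (specialUnitaryUnits (Fin N)) R₁ R₂ x).Reg335 c α₀ U → HasMaj (weightNorm (BlockNorm.ofBlocks (toB6 (geo9Y x) 1 (H x)) (𝔬12 x).blkZ) (fun y => ((((θ.ℓ₆ + 1 : ℕ) : ℝ) ^ (θ.d₆ + 1)) ^ lvl x.hN x.D x.hk y)⁻¹) (fun y => (plateau_pos x.toKIdx y).le)) (cNorm 1 (H x) (𝔬12 x).blk (fun y => (geo9Y_len_pos x y).le) 0) ((𝔬12 x).Qstar U) (fun a a' => BQ * Real.exp (-(δQ * (geo9Y x).dist a a'))))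
    -- [CASCADE-K «KD″»] THE KNIT INPUTS OF THE (3.137) LETTER (dag-n06-l ✓ `…D2SupPrechainV2AtPinsPUWQ.d2sup_prechain_v2_of_pins_knit`): x-free knit numerics, row 17 at the knit pair (`hΔ`), the `G̃` symmetry and the `Q`-class hom-letter laws
    {α₀' aK : ℝ} (hα' : 0 < α₀') (hαQ : α₀' ≤ alphaQ (θ.d₆ + 1) (θ.ℓ₆ + 1)) (hα3 : C0 (θ.d₆ + 1) * α₀' ≤ 1 / 3) (hα2 : 2 * α₀' ≤ c2' (θ.d₆ + 1) (θ.ℓ₆ + 1)) (haK : 0 < aK)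
    (hKpl : ∀ (x : MemberY θ.d₆ θ.ℓ₆ θ.hd' θ.hL' θ.b₀ θ.b₁ Mstar) (a : ℝ), 0 ≤ a → a ≤ aK → Kpl x.toKIdx a * (kGeo x.toKIdx).L ^ 4 < α₀')
    (hT16 : (α₀' * (2 * ((θ.d₆ : ℝ) + 1) * kCol (θ.d₆ + 1) (θ.ℓ₆ + 1) + 8 * ((θ.d₆ : ℝ) + 2) ^ 2)) ^ 2 * (2 * (N : ℝ) * θ.b₁) * (2 * ((θ.d₆ : ℝ) + 1) * Cth θ.d₆) ≤ θ.b₀ / 256)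
    (hΔ : ∀ x : MemberY θ.d₆ θ.ℓ₆ θ.hd' θ.hL' θ.b₀ θ.b₁ Mstar, M311 ≤ (geo9Y x).M → ∀ α₀ : ℝ, 0 < α₀ → (geo9Y x).M * α₀ ≤ a311 → ∀ U : (bg9YR (Matrix (Fin N) (Fin N) ℂ) (specialUnitaryUnits (Fin N)) R₁ R₂ x).Cfg, (bg9YR (Matrix (Fin N) (Fin N) ℂ) (specialUnitaryUnits (Fin N)) R₁ R₂ x).Reg335 c α₀ U → IsSymmTr (fun _ => (1 : ℝ)) (Δ x U) ∧ PosDefTr (fun _ => (1 : ℝ)) (Δ x U))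
    (hGDsym : ∀ x : MemberY θ.d₆ θ.ℓ₆ θ.hd' θ.hL' θ.b₀ θ.b₁ Mstar, M₀ ≤ (geo9Y x).M → ∀ α₀ : ℝ, 0 < α₀ → (geo9Y x).M * α₀ ≤ a₀ → ∀ U : (bg9YR (Matrix (Fin N) (Fin N) ℂ) (specialUnitaryUnits (Fin N)) R₁ R₂ x).Cfg, (bg9YR (Matrix (Fin N) (Fin N) ℂ) (specialUnitaryUnits (Fin N)) R₁ R₂ x).Reg335 c α₀ U → (bg9YR (Matrix (Fin N) (Fin N) ℂ) (specialUnitaryUnits (Fin N)) R₁ R₂ x).Reg336 c α₀ U → IsSymmTr (fun _ => (1 : ℝ)) (GDQY x.toKIdx (𝔮 x) (𝔮s x) (parKnitY x.toKIdx) (GpPhysY x.toKIdx (parKnitY x.toKIdx)) U))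
    {BQ15 : ℝ} (hBQ15 : 0 ≤ BQ15)
    (hQ15 : ∀ x : MemberY θ.d₆ θ.ℓ₆ θ.hd' θ.hL' θ.b₀ θ.b₁ Mstar, M₀ ≤ (geo9Y x).M → ∀ α₀ : ℝ, 0 < α₀ → (geo9Y x).M * α₀ ≤ a₀ → ∀ U : (bg9YR (Matrix (Fin N) (Fin N) ℂ) (specialUnitaryUnits (Fin N)) R₁ R₂ x).Cfg, (bg9YR (Matrix (Fin N) (Fin N) ℂ) (specialUnitaryUnits (Fin N)) R₁ R₂ x).Reg335 c α₀ U → (bg9YR (Matrix (Fin N) (Fin N) ℂ) (specialUnitaryUnits (Fin N)) R₁ R₂ x).Reg336 c α₀ U → ∀ δ : ℝ, 0 ≤ δ → HasMajorantHom (g := toB6 (geo9Y x) 1 (H x)) (blkBK x.toKIdx (bI x)) (blkHK x.toKIdx) (QcoKHq x.toKIdx (trBasis N) (bg9YR (Matrix (Fin N) (Fin N) ℂ) (specialUnitaryUnits (Fin N)) R₁ R₂ x) (fun U => U) (𝔮 x) U) (fun a a' => BQ15 * Real.exp (δ * ((θ.ℓ₆ : ℝ) + 4)) * Real.exp (-(δ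 * (geo9Y x).dist a a')))) :
    ∃ (MW aD θ₂ : ℝ) (BdT : ℝ → ℝ) (Bd2T : ℝ → ℝ → ℝ) (BdX BhD13 : ℝ → ℝ) (BZv : ℝ) (BXv : ℝ → ℝ) (BLv KX Bz Bxz : ℝ) (θS θD A₀S AW AQ AD AQ1 CR : ℝ) (θH AI AV : ℝ → ℝ), M₀ ≤ MW ∧ 0 < aD ∧ aD ≤ a₀ ∧ 0 ≤ θ₂ ∧ (∀ ε, 0 < ε → 0 ≤ BdT ε) ∧ (∀ ε β', 0 < ε → 0 ≤ β' → β' < 1 → 0 ≤ Bd2T ε β') ∧ (∀ β', 0 ≤ β' → β' < 1 → 0 ≤ BdX β') ∧ (∀ β', 0 ≤ β' → β' < 1 → 0 ≤ BhD13 β') ∧ 0 ≤ BZv ∧ (∀ β', 0 ≤ β' → β' < 1 → 0 ≤ BXv β') ∧ 0 ≤ BLv ∧ 0 ≤ KX ∧ 0 ≤ Bz ∧ 0 ≤ Bxz ∧ 0 ≤ θS ∧ 0 ≤ θD ∧ (∀ β, 0 ≤ β → β < 1 → 0 ≤ θH β) ∧ 0 ≤ A₀S ∧ 0 ≤ AW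 ∧ 0 ≤ AQ ∧ 0 ≤ AD ∧ 0 ≤ AQ1 ∧ 0 ≤ CR ∧ (∀ ε, 0 < ε → 0 ≤ AI ε) ∧ (∀ ε, 0 < ε → 0 ≤ AV ε) ∧
      -- (1) dag-n06-c UNIT D: the gradient letters ∇_{U,ν}G₀∇_U ∕ Φ^X_β∇_{U,ν}G₀∇_U out of the transported site class `bHXT x U ε`
      (∀ x : MemberY θ.d₆ θ.ℓ₆ θ.hd' θ.hL' θ.b₀ θ.b₁ Mstar, MW ≤ (geo9Y x).M → ∀ α₀ : ℝ, 0 < α₀ → (geo9Y x).M * α₀ ≤ a₀ → ∀ U : (bg9YR (Matrix (Fin N) (Fin N) ℂ) (specialUnitaryUnits (Fin N)) R₁ R₂ x).Cfg, (bg9YR (Matrix (Fin N) (Fin N) ℂ) (specialUnitaryUnits (Fin N)) R₁ R₂ x).Reg335 c α₀ U → (bg9YR (Matrix (Fin N) (Fin N) ℂ) (specialUnitaryUnits (Fin N)) R₁ R₂ x).Reg336 c α₀ U → (∀ (ν : Fin (θ.d₆ + 1)) (ε : ℝ), 0 < ε → HasMaj (bHXT x U ε) (BlockNorm.ofBlocks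 (toB6 (geo9Y x) 1 (H x)) (𝔬12 x).blk) ((𝔡A x).Dd U ν ∘ₗ ((𝔬12 x).G0 U ∘ₗ (𝔬12 x).Dv U)) (fun (a a' : (geo9Y x).Site) => BdT ε * Real.exp (-(δ13 * (geo9Y x).dist a a')))) ∧ (∀ (ν : Fin (θ.d₆ + 1)) (ε β' : ℝ), 0 < ε → 0 ≤ β' → β' < 1 → HasMaj (bHXT x U (β' + ε)) (BlockNorm.ofBlocks (toB6 (geo9Y x) 1 (H x)) (𝔭A x).blkPX) (((𝔭A x).ΦX U β' ∘ₗ (𝔡A x).Dd U ν) ∘ₗ ((𝔬12 x).G0 U ∘ₗ (𝔬12 x).Dv U)) (fun (a a' : (geo9Y x).Site) => Bd2T ε β' * (geo9Y x).len a ^ (-β') * Real.exp (-(δ13 * (geo9Y x).dist a a'))))) ∧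
      -- (2)–(4) the (3.46) letters at the site Hölder class `bH13 x U`: Φ^X∇_νG₀∇ (`hXd`), ∇_νG₀∇ ∕ ∇G₀∇ (`hdgDHd ∕ hdgDH`), Φ^Y∇G₀∇ (`hYd`)
      (∀ x : MemberY θ.d₆ θ.ℓ₆ θ.hd' θ.hL' θ.b₀ θ.b₁ Mstar, MW ≤ (geo9Y x).M → ∀ α₀ : ℝ, 0 < α₀ → (geo9Y x).M * α₀ ≤ a₀ → ∀ U : (bg9YR (Matrix (Fin N) (Fin N) ℂ) (specialUnitaryUnits (Fin N)) R₁ R₂ x).Cfg, (bg9YR (Matrix (Fin N) (Fin N) ℂ) (specialUnitaryUnits (Fin N)) R₁ R₂ x).Reg335 c α₀ U → (bg9YR (Matrix (Fin N) (Fin N) ℂ) (specialUnitaryUnits (Fin N)) R₁ R₂ x).Reg336 c α₀ U → ∀ (ν : Fin (θ.d₆ + 1)) (β' : ℝ), 0 ≤ β' → β' < 1 → HasMaj (bH13 x U) (cNormR 1 (H x) (𝔭A x).blkPX (fun y => (geo9Y_len_pos x y).le) (β' - 1)) (((𝔭A x).ΦX U β' ∘ₗ (𝔡A x).Dd U ν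 ∘ₗ (𝔬12 x).G0 U) ∘ₗ (𝔬12 x).Dv U) (fun a a' => BdX β' * Real.exp (-(δ13 * (geo9Y x).dist a a')))) ∧ (∀ x : MemberY θ.d₆ θ.ℓ₆ θ.hd' θ.hL' θ.b₀ θ.b₁ Mstar, MW ≤ (geo9Y x).M → ∀ α₀ : ℝ, 0 < α₀ → (geo9Y x).M * α₀ ≤ a₀ → ∀ U : (bg9YR (Matrix (Fin N) (Fin N) ℂ) (specialUnitaryUnits (Fin N)) R₁ R₂ x).Cfg, (bg9YR (Matrix (Fin N) (Fin N) ℂ) (specialUnitaryUnits (Fin N)) R₁ R₂ x).Reg335 c α₀ U → (bg9YR (Matrix (Fin N) (Fin N) ℂ) (specialUnitaryUnits (Fin N)) R₁ R₂ x).Reg336 c α₀ U → (∀ ν : Fin (θ.d₆ + 1), HasMaj (bH13 x U) (cNorm 1 (H x) (𝔬12 x).blk (fun y => (geo9Y_len_pos x y).le) 1) ((𝔡A x).Dd U ν ∘ₗ (𝔬12 x).G0 U ∘ₗ (𝔬12 x).Dv U) (fun a a' => B₃ * Real.exp (-(δ13 * (geo9Y x).dist a a')))) ∧ HasMaj (bH13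 x U) (cNorm 1 (H x) (𝔬12 x).blkY (fun y => (geo9Y_len_pos x y).le) 1) ((𝔬12 x).D U ∘ₗ (𝔬12 x).G0 U ∘ₗ (𝔬12 x).Dv U) (fun a a' => B₃ * Real.exp (-(δ13 * (geo9Y x).dist a a')))) ∧ (∀ x : MemberY θ.d₆ θ.ℓ₆ θ.hd' θ.hL' θ.b₀ θ.b₁ Mstar, MW ≤ (geo9Y x).M → ∀ α₀ : ℝ, 0 < α₀ → (geo9Y x).M * α₀ ≤ a₀ → ∀ U : (bg9YR (Matrix (Fin N) (Fin N) ℂ) (specialUnitaryUnits (Fin N)) R₁ R₂ x).Cfg, (bg9YR (Matrix (Fin N) (Fin N) ℂ) (specialUnitaryUnits (Fin N)) R₁ R₂ x).Reg335 c α₀ U →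
          (bg9YR (Matrix (Fin N) (Fin N) ℂ) (specialUnitaryUnits (Fin N)) R₁ R₂ x).Reg336 c α₀ U → ∀ β' : ℝ, 0 ≤ β' → β' < 1 → HasMaj (bH13 x U) (cNormR 1 (H x) (𝔭A x).blkPY (fun y => (geo9Y_len_pos x y).le) (β' - 1)) (((𝔭A x).ΦY U β' ∘ₗ (𝔬12 x).D U ∘ₗ (𝔬12 x).G0 U) ∘ₗ (𝔬12 x).Dv U) (fun a a' => BhD13 β' * Real.exp (-(δ13 * (geo9Y x).dist a a')))) ∧
      -- (5)–(7) the ∇-letters (`hZ1 hpXDv` + the block-L² words), the Φ^X∇ letter at `KX·Bh12`, dag-n06-l's G₀Q⋆ transfer letters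
      (∀ x : MemberY θ.d₆ θ.ℓ₆ θ.hd' θ.hL' θ.b₀ θ.b₁ Mstar, MW ≤ (geo9Y x).M → ∀ α₀ : ℝ, 0 < α₀ → (geo9Y x).M * α₀ ≤ a₀ → ∀ U : (bg9YR (Matrix (Fin N) (Fin N) ℂ) (specialUnitaryUnits (Fin N)) R₁ R₂ x).Cfg, (bg9YR (Matrix (Fin N) (Fin N) ℂ) (specialUnitaryUnits (Fin N)) R₁ R₂ x).Reg335 c α₀ U → (bg9YR (Matrix (Fin N) (Fin N) ℂ) (specialUnitaryUnits (Fin N)) R₁ R₂ x).Reg336 c α₀ U → HasMaj (cNorm 1 (H x) (𝔬12 x).blkW (fun y => (geo9Y_len_pos x y).le) 1) (cNorm 1 (H x) (𝔬12 x).blk (fun y => (geo9Y_len_pos x y).le) 2) ((𝔬12 x).G0 U ∘ₗ (𝔬12 x).Dv U) (fun a b => BZv * Real.exp (-(δ13 * (geo9Y x).dist a b))) ∧ (∀ β' : ℝ, 0 ≤ β' → β' < 1 → HasMaj (cNormR 1 (H x) (𝔬12 x).blkW (fun y => (geo9Y_len_pos x y).le) 0) (cNormR 1 (H x) (𝔭A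 x).blkPX (fun y => (geo9Y_len_pos x y).le) (β' - 1)) (((𝔭A x).ΦX U β' ∘ₗ (𝔬12 x).G0 U) ∘ₗ (𝔬12 x).Dv U) (fun a b => BXv β' * Real.exp (-(δ13 * (geo9Y x).dist a b)))) ∧ BlockBd (g := toB6 (geo9Y x) 1 (H x)) (𝔬12 x).blkW (𝔬12 x).blk ((𝔬12 x).G0 U ∘ₗ (𝔬12 x).Dv U) (fun (y y' : (geo9Y x).Site) => BLv * (geo9Y x).len y * Real.exp (-(δ13 * (geo9Y x).dist y y'))) ∧ BlockBd (g := toB6 (geo9Y x) 1 (H x)) (𝔬12 x).blkW (𝔬12 x).blkY ((𝔬12 x).D U ∘ₗ (𝔬12 x).G0 U ∘ₗ (𝔬12 x).Dv U) (fun (y y' : (geo9Y x).Site) => BLv * Real.exp (-(δ13 * (geo9Y x).dist y y'))) ∧ (∀ ν : Fin (θ.d₆ + 1), BlockBd (g := toB6 (geo9Y x) 1 (H x)) (𝔬12 x).blkW (𝔬12 x).blk ((𝔡A x).Dd U ν ∘ₗ (𝔬12 x).G0 U ∘ₗ (𝔬12 x).Dv U) (fun (y y' : (geo9Y x).Site)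 => BLv * Real.exp (-(δ13 * (geo9Y x).dist y y'))))) ∧
      (∀ x : MemberY θ.d₆ θ.ℓ₆ θ.hd' θ.hL' θ.b₀ θ.b₁ Mstar, MW ≤ (geo9Y x).M → ∀ α₀ : ℝ, 0 < α₀ → (geo9Y x).M * α₀ ≤ a₀ → ∀ U : (bg9YR (Matrix (Fin N) (Fin N) ℂ) (specialUnitaryUnits (Fin N)) R₁ R₂ x).Cfg, (bg9YR (Matrix (Fin N) (Fin N) ℂ) (specialUnitaryUnits (Fin N)) R₁ R₂ x).Reg335 c α₀ U → (bg9YR (Matrix (Fin N) (Fin N) ℂ) (specialUnitaryUnits (Fin N)) R₁ R₂ x).Reg336 c α₀ U → ∀ β' : ℝ, 0 ≤ β' → β' < 1 → HasMaj (cNormR 1 (H x) (𝔬12 x).blkW (fun y => (geo9Y_len_pos x y).le) 0) (cNormR 1 (H x) (𝔭A x).blkPX (fun y => (geo9Y_len_pos x y).le) (β' - 1)) (((𝔭A x).ΦX U β' ∘ₗ (𝔬12 x).G0 U) ∘ₗ (𝔬12 x).Dv U) (fun a b => KX * Bh12 β' * Real.exp (-(δ13 * (geo9Y x).dist a b))))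 ∧ (∀ x : MemberY θ.d₆ θ.ℓ₆ θ.hd' θ.hL' θ.b₀ θ.b₁ Mstar, MW ≤ (geo9Y x).M → ∀ α₀ : ℝ, 0 < α₀ → (geo9Y x).M * α₀ ≤ a₀ → ∀ U : (bg9YR (Matrix (Fin N) (Fin N) ℂ) (specialUnitaryUnits (Fin N)) R₁ R₂ x).Cfg, (bg9YR (Matrix (Fin N) (Fin N) ℂ) (specialUnitaryUnits (Fin N)) R₁ R₂ x).Reg335 c α₀ U → (bg9YR (Matrix (Fin N) (Fin N) ℂ) (specialUnitaryUnits (Fin N)) R₁ R₂ x).Reg336 c α₀ U → HasMaj (weightNorm (BlockNorm.ofBlocks (toB6 (geo9Y x) 1 (H x)) (𝔬12 x).blkZ) (fun y => (geo9Y x).len y * (fun y => ((((θ.ℓ₆ + 1 : ℕ) : ℝ) ^ (θ.d₆ + 1)) ^ lvl x.hN x.D x.hk y)⁻¹) y) (fun y => (mul_pos (geo9Y_len_pos x y) (plateau_pos x.toKIdx y)).le)) (cNorm 1 (H x) (𝔬12 x).blk (fun y => (geo9Y_len_pos x y).le) 1) ((𝔬12 x).G0 U ∘ₗ (𝔬12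 x).Qstar U) (fun a b => Bz * Real.exp (-(δ13 * (geo9Y x).dist a b))) ∧ (∀ β : ℝ, 0 ≤ β → β < 1 →
          HasMaj (weightNorm (BlockNorm.ofBlocks (toB6 (geo9Y x) 1 (H x)) (𝔬12 x).blkZ) (fun y => (geo9Y x).len y * (fun y => ((((θ.ℓ₆ + 1 : ℕ) : ℝ) ^ (θ.d₆ + 1)) ^ lvl x.hN x.D x.hk y)⁻¹) y) (fun y => (mul_pos (geo9Y_len_pos x y) (plateau_pos x.toKIdx y)).le)) (cNormR 1 (H x) (𝔭A x).blkPX (fun y => (geo9Y_len_pos x y).le) (β - 1)) (((𝔭A x).ΦX U β ∘ₗ (𝔬12 x).G0 U) ∘ₗ (𝔬12 x).Qstar U) (fun a b => Bxz * Real.exp (-(δ13 * (geo9Y x).dist a b))))) ∧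
      -- (8) the Δ⁽²⁾ letter (3.137) DERIVED (dag-n06-l `d2sup_prechain_of_pins`), on the sub-regime `aD`
      (∀ x : MemberY θ.d₆ θ.ℓ₆ θ.hd' θ.hL' θ.b₀ θ.b₁ Mstar, MW ≤ (geo9Y x).M → ∀ α₀ : ℝ, 0 < α₀ → (geo9Y x).M * α₀ ≤ aD → ∀ U : (bg9YR (Matrix (Fin N) (Fin N) ℂ) (specialUnitaryUnits (Fin N)) R₁ R₂ x).Cfg, (bg9YR (Matrix (Fin N) (Fin N) ℂ) (specialUnitaryUnits (Fin N)) R₁ R₂ x).Reg335 c α₀ U → (bg9YR (Matrix (Fin N) (Fin N) ℂ) (specialUnitaryUnits (Fin N)) R₁ R₂ x).Reg336 c α₀ U → HasMajorant (g := toB6 (geo9Y x) 1 (H x)) (𝔬12 x).blk (D2coK x.toKIdx (trBasis N) (bg9YR (Matrix (Fin N) (Fin N) ℂ) (specialUnitaryUnits (Fin N)) R₁ R₂ x) (fun U => U) (Δ2 x) U) (fun (a b : (geo9Y x).Site) => θ₂ * ((geo9Y x).M * α₀) * ((geo9Y x).len a ^ 2)⁻¹ * Real.exp (-(δ₂ *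 (geo9Y x).dist a b)))) ∧
      -- (9) the U8 state layer at (δK, δP) on the sub-regime `aD`: the four state tuples `hst20 ∧ hst10 ∧ hst21 ∧ hst11`
      (∀ x : MemberY θ.d₆ θ.ℓ₆ θ.hd' θ.hL' θ.b₀ θ.b₁ Mstar, MW ≤ (geo9Y x).M → ∀ α₀ : ℝ, 0 < α₀ → (geo9Y x).M * α₀ ≤ aD → ∀ U : (bg9YR (Matrix (Fin N) (Fin N) ℂ) (specialUnitaryUnits (Fin N)) R₁ R₂ x).Cfg, (bg9YR (Matrix (Fin N) (Fin N) ℂ) (specialUnitaryUnits (Fin N)) R₁ R₂ x).Reg335 c α₀ U → (bg9YR (Matrix (Fin N) (Fin N) ℂ) (specialUnitaryUnits (Fin N)) R₁ R₂ x).Reg336 c α₀ U → (StepS (𝔬12 x) (weightNorm (bXH x U) (rwt (geo9Y x) (-1)) (rwt_nonneg (fun y => (geo9Y_len_pos x y).le) (-1))) (θS * ((geo9Y x).M * α₀)) δK U ∧ (HasMaj (weightNorm (bXH x U) (rwt (geo9Y x) (-1)) (rwt_nonneg (fun y => (geo9Y_len_pos x y).le) (-1))) (cNorm 1 (H x) (𝔬12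 x).blkY (fun y => (geo9Y_len_pos x y).le) 1) ((𝔬12 x).D U ∘ₗ (𝔬12 x).G0 U ∘ₗ (𝔬12 x).Tpi U) (fun a b => θD * ((geo9Y x).M * α₀) * Real.exp (-(δK * (geo9Y x).dist a b))) ∧ HasMaj (weightNorm (bXH x U) (rwt (geo9Y x) (-1)) (rwt_nonneg (fun y => (geo9Y_len_pos x y).le) (-1))) (cNorm 1 (H x) (𝔬12 x).blkY (fun y => (geo9Y_len_pos x y).le) 1) ((𝔬12 x).D U ∘ₗ (𝔬12 x).G0 U ∘ₗ ((𝔬12 x).Tpi U + (𝔬12 x).T2 U)) (fun a b => θD * ((geo9Y x).M * α₀) * Real.exp (-(δK * (geo9Y x).dist a b)))) ∧ (∀ β : ℝ, 0 ≤ β → β < 1 → HasMaj (weightNorm (bXH x U) (rwt (geo9Y x) (-1)) (rwt_nonneg (fun y => (geo9Y_len_pos x y).le) (-1))) (cNormR 1 (H x) (𝔭A x).blkPY (fun y => (geo9Y_len_pos x y).le) (β - 1)) (((𝔭A x).ΦY U β ∘ₗ (𝔬12 x).D U ∘ₗ (𝔬12 x).G0 U) ∘ₗ (𝔬12 x).Tpi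 U) (fun a b => θH β * ((geo9Y x).M * α₀) * Real.exp (-(δK * (geo9Y x).dist a b))) ∧
            HasMaj (weightNorm (bXH x U) (rwt (geo9Y x) (-1)) (rwt_nonneg (fun y => (geo9Y_len_pos x y).le) (-1))) (cNormR 1 (H x) (𝔭A x).blkPY (fun y => (geo9Y_len_pos x y).le) (β - 1)) (((𝔭A x).ΦY U β ∘ₗ (𝔬12 x).D U ∘ₗ (𝔬12 x).G0 U) ∘ₗ ((𝔬12 x).Tpi U + (𝔬12 x).T2 U)) (fun a b => θH β * ((geo9Y x).M * α₀) * Real.exp (-(δK * (geo9Y x).dist a b)))) ∧ HasMaj (cNorm 1 (H x) (𝔬12 x).blk (fun y => (geo9Y_len_pos x y).le) 0) (weightNorm (bXH x U) (rwt (geo9Y x) (-1)) (rwt_nonneg (fun y => (geo9Y_len_pos x y).le) (-1))) ((𝔬12 x).G0 U) (fun a b => A₀S * Real.exp (-(δP * (geo9Y x).dist a b))) ∧ HasMaj (weightNorm (BlockNorm.ofBlocks (toB6 (geo9Y x) 1 (H x)) (𝔬12 x).blkZ) (fun y => ((((θ.ℓ₆ + 1 : ℕ) : ℝ) ^ (θ.d₆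 + 1)) ^ lvl x.hN x.D x.hk y)⁻¹) (fun y => (plateau_pos x.toKIdx y).le)) (weightNorm (bXH x U) (rwt (geo9Y x) (-1)) (rwt_nonneg (fun y => (geo9Y_len_pos x y).le) (-1))) ((𝔬12 x).G0 U ∘ₗ (𝔬12 x).Qstar U) (fun a b => AQ * Real.exp (-(δP * (geo9Y x).dist a b))) ∧ HasMaj (weightNorm (bXH x U) (rwt (geo9Y x) (-1)) (rwt_nonneg (fun y => (geo9Y_len_pos x y).le) (-1))) (cNormR 1 (H x) (𝔬12 x).blk (fun y => (geo9Y_len_pos x y).le) (-2)) LinearMap.id (fun a b => CR * Real.exp (-(δP * (geo9Y x).dist a b))) ∧ (weightNorm (bXH x U) (rwt (geo9Y x) (-1)) (rwt_nonneg (fun y => (geo9Y_len_pos x y).le) (-1))).κ ≤ (1 + CLip θ.d₆ θ.ℓ₆) ∧ (∃ Λ : ℝ, 0 ≤ Λ ∧ ∀ (y : (geo9Y x).Site) (F : XBK (TrIdx N) x.toKIdx → ℝ), (weightNorm (bXH x U) (rwt (geo9Y x) (-1)) (rwt_nonneg (fun y => (geo9Y_len_pos x y).le) (-1))).loc y F ≤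 Λ * ∑ q : XBK (TrIdx N) x.toKIdx, |F q|)) ∧ (StepS (𝔬12 x) (bXH x U) (θS * ((geo9Y x).M * α₀)) δK U ∧ (∀ ν : Fin (θ.d₆ + 1),
            HasMaj (bXH x U) (cNormR 1 (H x) (𝔬12 x).blk (fun y => (geo9Y_len_pos x y).le) 0) ((𝔡A x).Dd U ν ∘ₗ (𝔬12 x).G0 U ∘ₗ (𝔬12 x).Tpi U) (fun a b => θD * ((geo9Y x).M * α₀) * Real.exp (-(δK * (geo9Y x).dist a b))) ∧ HasMaj (bXH x U) (cNormR 1 (H x) (𝔬12 x).blk (fun y => (geo9Y_len_pos x y).le) 0) ((𝔡A x).Dd U ν ∘ₗ (𝔬12 x).G0 U ∘ₗ ((𝔬12 x).Tpi U + (𝔬12 x).T2 U)) (fun a b => θD * ((geo9Y x).M * α₀) * Real.exp (-(δK * (geo9Y x).dist a b)))) ∧ (∀ β : ℝ, 0 ≤ β → β < 1 → HasMaj (bXH x U) (cNormR 1 (H x) (𝔭A x).blkPX (fun y => (geo9Y_len_pos x y).le) (β - 1)) (((𝔭A x).ΦX U β ∘ₗ (𝔬12 x).G0 U) ∘ₗ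 (𝔬12 x).Tpi U) (fun a b => θH β * ((geo9Y x).M * α₀) * Real.exp (-(δK * (geo9Y x).dist a b))) ∧ HasMaj (bXH x U) (cNormR 1 (H x) (𝔭A x).blkPX (fun y => (geo9Y_len_pos x y).le) (β - 1)) (((𝔭A x).ΦX U β ∘ₗ (𝔬12 x).G0 U) ∘ₗ ((𝔬12 x).Tpi U + (𝔬12 x).T2 U)) (fun a b => θH β * ((geo9Y x).M * α₀) * Real.exp (-(δK * (geo9Y x).dist a b)))) ∧ (∀ (ν : Fin (θ.d₆ + 1)) (β : ℝ), 0 ≤ β → β < 1 → HasMaj (bXH x U) (cNormR 1 (H x) (𝔭A x).blkPX (fun y => (geo9Y_len_pos x y).le) β) (((𝔭A x).ΦX U β ∘ₗ (𝔡A x).Dd U ν ∘ₗ (𝔬12 x).G0 U) ∘ₗ (𝔬12 x).Tpi U) (fun a b => θH β * ((geo9Y x).M * α₀) * Real.exp (-(δK * (geo9Y x).dist a b))) ∧ HasMaj (bXH x U) (cNormR 1 (H x) (𝔭A x).blkPX (fun y => (geo9Y_len_pos x y).le) β) (((𝔭A x).ΦX U β ∘ₗ (𝔡A x).Dd U ν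 ∘ₗ (𝔬12 x).G0 U) ∘ₗ ((𝔬12 x).Tpi U + (𝔬12 x).T2 U)) (fun a b => θH β * ((geo9Y x).M * α₀) * Real.exp (-(δK * (geo9Y x).dist a b)))) ∧ HasMaj (cNormR 1 (H x) (𝔬12 x).blkY (fun y => (geo9Y_len_pos x y).le) 0) (bXH x U) ((𝔬12 x).G0 U ∘ₗ (𝔬12 x).Dstar U) (fun a b => AD * Real.exp (-(δP * (geo9Y x).dist a b))) ∧
          (∀ (μ : Fin (θ.d₆ + 1)) (ε : ℝ), 0 < ε → HasMaj (bHXA x ε) (bXH x U) ((𝔬12 x).G0 U ∘ₗ (𝔡A x).Dsd U μ) (fun a b => AI ε * Real.exp (-(δP * (geo9Y x).dist a b)))) ∧ HasMaj (bXH x U) (cNormR 1 (H x) (𝔬12 x).blk (fun y => (geo9Y_len_pos x y).le) (-1)) LinearMap.id (fun a b => CR * Real.exp (-(δP * (geo9Y x).dist a b))) ∧ (bXH x U).κ ≤ (1 + CLip θ.d₆ θ.ℓ₆) ∧ (∃ Λ : ℝ, 0 ≤ Λ ∧ ∀ (y : (geo9Y x).Site) (F : XBK (TrIdx N) x.toKIdx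 → ℝ), (bXH x U).loc y F ≤ Λ * ∑ q : XBK (TrIdx N) x.toKIdx, |F q|)) ∧ (StepS (𝔬12 x) (weightNorm (bXH x U) (rwt (geo9Y x) (-1)) (rwt_nonneg (fun y => (geo9Y_len_pos x y).le) (-1))) (θS * ((geo9Y x).M * α₀)) δK U ∧ HasMaj (weightNorm (bXH x U) (rwt (geo9Y x) (-1)) (rwt_nonneg (fun y => (geo9Y_len_pos x y).le) (-1))) (cNorm 1 (H x) (𝔬12 x).blkY (fun y => (geo9Y_len_pos x y).le) 1) ((𝔬12 x).D U ∘ₗ (𝔬12 x).G0 U ∘ₗ ((𝔬12 x).Tpi U + (𝔬12 x).T2 U)) (fun a b => θD * ((geo9Y x).M * α₀) * Real.exp (-(δK * (geo9Y x).dist a b))) ∧ (∀ ν : Fin (θ.d₆ + 1), HasMaj (weightNorm (bXH x U) (rwt (geo9Y x) (-1)) (rwt_nonneg (fun y => (geo9Y_len_pos x y).le) (-1))) (cNorm 1 (H x) (𝔬12 x).blk (fun y => (geo9Y_len_pos x y).le) 1) ((𝔡A x).Dd U ν ∘ₗ (𝔬12 x).G0 U ∘ₗ ((𝔬12 x).Tpi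 U + (𝔬12 x).T2 U)) (fun a b => θD * ((geo9Y x).M * α₀) * Real.exp (-(δK * (geo9Y x).dist a b)))) ∧ (∀ β : ℝ, 0 ≤ β → β < 1 → HasMaj (weightNorm (bXH x U) (rwt (geo9Y x) (-1)) (rwt_nonneg (fun y => (geo9Y_len_pos x y).le) (-1))) (cNormR 1 (H x) (𝔭A x).blkPY (fun y => (geo9Y_len_pos x y).le) (β - 1)) (((𝔭A x).ΦY U β ∘ₗ (𝔬12 x).D U ∘ₗ (𝔬12 x).G0 U) ∘ₗ ((𝔬12 x).Tpi U + (𝔬12 x).T2 U)) (fun a b => θH β * ((geo9Y x).M * α₀) * Real.exp (-(δK * (geo9Y x).dist a b)))) ∧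
          (∀ (ν : Fin (θ.d₆ + 1)) (β : ℝ), 0 ≤ β → β < 1 → HasMaj (weightNorm (bXH x U) (rwt (geo9Y x) (-1)) (rwt_nonneg (fun y => (geo9Y_len_pos x y).le) (-1))) (cNormR 1 (H x) (𝔭A x).blkPX (fun y => (geo9Y_len_pos x y).le) (β - 1)) (((𝔭A x).ΦX U β ∘ₗ (𝔡A x).Dd U ν ∘ₗ (𝔬12 x).G0 U) ∘ₗ ((𝔬12 x).Tpi U + (𝔬12 x).T2 U)) (fun a b => θH β * ((geo9Y x).M * α₀) * Real.exp (-(δK * (geo9Y x).dist a b)))) ∧ HasMaj (cNorm 1 (H x) (𝔬12 x).blk (fun y => (geo9Y_len_pos x y).le) 0) (weightNorm (bXH x U) (rwt (geo9Y x) (-1)) (rwt_nonneg (fun y => (geo9Y_len_pos x y).le) (-1))) ((𝔬12 x).G0 U) (fun a b => A₀S * Real.exp (-(δP * (geo9Y x).dist a b))) ∧ HasMaj (cNorm 1 (H x) (𝔬12 x).blkW (fun y => (geo9Y_len_pos x y).le) 1) (weightNorm (bXH x U) (rwt (geo9Y x) (-1)) (rwt_nonneg (fun y => (geo9Y_len_pos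 x y).le) (-1))) ((𝔬12 x).G0 U ∘ₗ (𝔬12 x).Dv U) (fun a b => AW * Real.exp (-(δP * (geo9Y x).dist a b))) ∧ HasMaj (weightNorm (BlockNorm.ofBlocks (toB6 (geo9Y x) 1 (H x)) (𝔬12 x).blkZ) (fun y => ((((θ.ℓ₆ + 1 : ℕ) : ℝ) ^ (θ.d₆ + 1)) ^ lvl x.hN x.D x.hk y)⁻¹) (fun y => (plateau_pos x.toKIdx y).le)) (weightNorm (bXH x U) (rwt (geo9Y x) (-1)) (rwt_nonneg (fun y => (geo9Y_len_pos x y).le) (-1))) ((𝔬12 x).G0 U ∘ₗ (𝔬12 x).Qstar U) (fun a b => AQ * Real.exp (-(δP * (geo9Y x).dist a b))) ∧ HasMaj (weightNorm (bXH x U) (rwt (geo9Y x) (-1)) (rwt_nonneg (fun y => (geo9Y_len_pos x y).le) (-1))) (cNormR 1 (H x) (𝔬12 x).blk (fun y => (geo9Y_len_pos x y).le) (-2)) LinearMap.id (fun a b => CR * Real.exp (-(δP * (geo9Y x).dist a b))) ∧ (∃ Λ : ℝ, 0 ≤ Λ ∧ ∀ (y : (geo9Y x).Site) (F : XBK (TrIdx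 N) x.toKIdx → ℝ), (weightNorm (bXH x U) (rwt (geo9Y x) (-1)) (rwt_nonneg (fun y => (geo9Y_len_pos x y).le) (-1))).loc y F ≤ Λ * ∑ q : XBK (TrIdx N) x.toKIdx, |F q|)) ∧
        (StepS (𝔬12 x) (bXH x U) (θS * ((geo9Y x).M * α₀)) δK U ∧ (∀ ν : Fin (θ.d₆ + 1), HasMaj (bXH x U) (cNormR 1 (H x) (𝔬12 x).blk (fun y => (geo9Y_len_pos x y).le) 0) ((𝔡A x).Dd U ν ∘ₗ (𝔬12 x).G0 U ∘ₗ ((𝔬12 x).Tpi U + (𝔬12 x).T2 U)) (fun a b => θD * ((geo9Y x).M * α₀) * Real.exp (-(δK * (geo9Y x).dist a b)))) ∧ (∀ β : ℝ, 0 ≤ β → β < 1 → HasMaj (bXH x U) (cNormR 1 (H x) (𝔭A x).blkPX (fun y => (geo9Y_len_pos x y).le) (β - 1)) (((𝔭A x).ΦX U β ∘ₗ (𝔬12 x).G0 U) ∘ₗ ((𝔬12 x).Tpi U + (𝔬12 x).T2 U)) (fun a b => θH β * ((geo9Y x).M * α₀) * Real.exp (-(δK * (geo9Y x).dist a b))))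 ∧ (∀ (ν : Fin (θ.d₆ + 1)) (β : ℝ), 0 ≤ β → β < 1 → HasMaj (bXH x U) (cNormR 1 (H x) (𝔭A x).blkPX (fun y => (geo9Y_len_pos x y).le) β) (((𝔭A x).ΦX U β ∘ₗ (𝔡A x).Dd U ν ∘ₗ (𝔬12 x).G0 U) ∘ₗ ((𝔬12 x).Tpi U + (𝔬12 x).T2 U)) (fun a b => θH β * ((geo9Y x).M * α₀) * Real.exp (-(δK * (geo9Y x).dist a b)))) ∧ HasMaj (cNormR 1 (H x) (𝔬12 x).blkY (fun y => (geo9Y_len_pos x y).le) 0) (bXH x U) ((𝔬12 x).G0 U ∘ₗ (𝔬12 x).Dstar U) (fun a b => AD * Real.exp (-(δP * (geo9Y x).dist a b))) ∧ (∀ (μ : Fin (θ.d₆ + 1)) (ε : ℝ), 0 < ε → HasMaj (bHXA x ε) (bXH x U) ((𝔬12 x).G0 U ∘ₗ (𝔡A x).Dsd U μ) (fun a b => AI ε * Real.exp (-(δP * (geo9Y x).dist a b)))) ∧ (∀ ε : ℝ, 0 < ε → HasMaj (bHXT x U ε) (bXH x U) ((𝔬12 x).G0 U ∘ₗ (𝔬12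 x).Dv U) (fun a b => AV ε * Real.exp (-(δP * (geo9Y x).dist a b)))) ∧ HasMaj (weightNorm (BlockNorm.ofBlocks (toB6 (geo9Y x) 1 (H x)) (𝔬12 x).blkZ) (fun y => (geo9Y x).len y * ((((θ.ℓ₆ + 1 : ℕ) : ℝ) ^ (θ.d₆ + 1)) ^ lvl x.hN x.D x.hk y)⁻¹) (fun y => (mul_pos (geo9Y_len_pos x y) (plateau_pos x.toKIdx y)).le)) (bXH x U) ((𝔬12 x).G0 U ∘ₗ (𝔬12 x).Qstar U) (fun a b => AQ1 * Real.exp (-(δP * (geo9Y x).dist a b))) ∧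
          HasMaj (bXH x U) (cNormR 1 (H x) (𝔬12 x).blk (fun y => (geo9Y_len_pos x y).le) (-1)) LinearMap.id (fun a b => CR * Real.exp (-(δP * (geo9Y x).dist a b))) ∧ (∃ Λ : ℝ, 0 ≤ Λ ∧ ∀ (y : (geo9Y x).Site) (F : XBK (TrIdx N) x.toKIdx → ℝ), (bXH x U).loc y F ≤ Λ * ∑ q : XBK (TrIdx N) x.toKIdx, |F q|))):= by
  have hG' : ∀ x : MemberY θ.d₆ θ.ℓ₆ θ.hd' θ.hL' θ.b₀ θ.b₁ Mstar, GeoOK (geo9Y x) := fun x => ⟨geo9Y_dist_triangle x, geo9Y_dist_comm x, geo9K_dist_nonneg x.toKIdx, geo9Y_len_pos x⟩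
  have hδ13 : 0 ≤ δ13 := by linarith only [hP3, hKP, hδK0, hσ, hτ]
  obtain ⟨MLR, c₁R, hrowR⟩ := rowSum261_geo9Y (d := θ.d₆) (ℓ := θ.ℓ₆) (hd := θ.hd') (hL := θ.hL') (b₀ := θ.b₀) (b₁ := θ.b₁) (Mstar := Mstar) 1 one_pos
  -- §1 THE LEVEL-13 LETTERS AT THE INTERMEDIATE RATE δ13: dag-n06-c's gradient leg (UNIT D), the three (3.46) legs, the ∇-letters, the Φ^X∇-letter, dag-n06-l's G₀Q⋆ transfer letters
  obtain ⟨MDL, BdT, Bd2T, hMDL, hBdT, hBd2T, hLEG⟩ := dgDvd_pdgDvd_of_pinsT_all (N := N) H bI hβ1 𝔬12 𝔭A (fun x => (𝔡A x).Dd) (fun x => (𝔡A x).Dsd) h𝔡As hDvco12 bHXT hbHXT bHXTA hbHXTA hc10 hP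
    ha₀ hδ13 h130.le hBiT hBi2T hG0CT
  obtain ⟨MXd, BdX, hBdX, hXd⟩ := hXd_of_pinsP_geo9Y (N := N) (M₀ := M₀) (a₀ := a₀) H bI hβ1 hbI0 hGR c hϑF hF w13 hw13₀ hw13₁ sch hsch0 hsch1 hwsch bH13 hbH13 𝔬A 𝔬12 hDvco12 𝔡A h𝔡As 𝔭A
    hδ13 h1345 hBZ h45X
  obtain ⟨MDg, hDg⟩ := dgDH_dgDHd_of_pinsP_geo9Y (N := N) (M₀ := M₀) (a₀ := a₀) H bI hβ1 hbI0 hGR c hϑF hF w13 hw13₀ hw13₁ hs440 hs441 hw1344 bH13 hbH13 𝔬A 𝔬12 hDvco12 𝔡A h𝔡As h𝔡Ad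
    hblk12 hblkY12 hDco12 hδ13 h1344 hBi44 hB3d hB3p h44m
  obtain ⟨MYd, BhD, hBhD, hYd⟩ := pYDH_of_pinsP_geo9Y (N := N) (M₀ := M₀) (a₀ := a₀) H bI hβ1 hbI0 hGR c hϑF hF w13 hw13₀ hw13₁ sch hsch0 hsch1 hwsch bH13 hbH13 𝔬A 𝔬12 hDvco12 𝔡A h𝔡As 𝔭A
    hδ13 h1345Y hBiY h45Y
  obtain ⟨MDv, BZv, BXv, BLv, hMDv, hBZv, hBXv, hBLv, hDV⟩ := dv_letters_of_pins θ Mstar hGR bI hβ1 H 𝔬12 𝔭A parB h𝔭A O (fun x => (𝔡A x).Dd) (fun x => (𝔡A x).Dsd) h𝔡Ad h𝔡As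
    hblk12 hblkW12 hblkY12 hG0co12 hDco12 hDsco12 hDvco12 (M12 := M₀) (a12 := a₀) hB12₀ hB12₂ hBh12 hδ13 h130 hG0DR hG0L2M (fun x hM α₀ hα ha U hU hU' => (hG0D x hM α₀ hα ha U hU hU').h43R)
  obtain ⟨MDx, KX, hMDx, hKX, hPX⟩ := pXDv_of_pins_KX θ Mstar hGR bI hβ1 H 𝔬12 𝔭A parB h𝔭A O (fun x => (𝔡A x).Dsd) h𝔡As hblk12 hblkW12 hblkY12 hG0co12 hDsco12 hDvco12
    (M12 := M₀) (a12 := a₀) (Bh12 := Bh12) hBh12 hδ13 h130.le (fun x hM α₀ hα ha U hU hU' => (hG0D x hM α₀ hα ha U hU hU').h43R)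
  obtain ⟨Mz, Bz, Bxz, hM0z, hBz, hBxz, hGT⟩ := N06G0QstarTransferLegAtPinsPULaws.g0qstar_transfer_letters_of_laws θ Mstar hGR bI hlev hβ1 H 𝔬12 𝔭A parB hparB h𝔭A (fun x => (𝔡A x).Dd) h𝔡Ad hblk12
    (M12 := M₀) (a12 := a₀) hB12₀ hδ13 h130 BQ δQ hBQ hδQ1 hqsK (fun x hM α₀ hα ha U hU hU' => (hG0 x hM α₀ hα ha U hU hU').e0) (fun x hM α₀ hα ha U hU hU' => (hG0D x hM α₀ hα ha U hU hU').e1d)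
  have hBxK : ∀ β : ℝ, 0 ≤ β → β < 1 → 0 ≤ KX * Bh12 β := fun β h0 h1 => mul_nonneg hKX (hBh12 β h0 h1)
  have hBxM : ∀ β : ℝ, 0 ≤ β → β < 1 → 0 ≤ max Bxz (KX * Bh12 β) := fun β _ _ => hBxz.trans (le_max_left _ _)
  have hBx0M : 0 ≤ max Bxz (KX * BHG) := hBxz.trans (le_max_left _ _)
  have hwBxM : ∀ s : ℝ, 0 < s → s < 1 → wX s * max Bxz (KX * Bh12 s) ≤ max Bxz (KX * BHG) := fun s h0 h1 => by
    rw [mul_max_of_nonneg _ _ (hwX₀ s)]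
    exact max_le_max (mul_le_of_le_one_left hBxz (hwX₁ s)) (by rw [mul_left_comm]; exact mul_le_mul_of_nonneg_left (hwBhG s h0 h1) hKX)
  obtain ⟨MW, hMDLW, hMXdW, hMDgW, hMYdW, hMDvW, hMDxW, hMzW, hMLRW⟩ : ∃ MW : ℝ, MDL ≤ MW ∧ MXd ≤ MW ∧ MDg ≤ MW ∧ MYd ≤ MW ∧ MDv ≤ MW ∧ MDx ≤ MW ∧ Mz ≤ MW ∧ MLR ≤ MW :=
    ⟨max (max (max MDL MXd) (max MDg MYd)) (max (max MDv MDx) (max Mz MLR)),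
      ((le_max_left _ _).trans (le_max_left _ _)).trans (le_max_left _ _), ((le_max_right _ _).trans (le_max_left _ _)).trans (le_max_left _ _),
      ((le_max_left _ _).trans (le_max_right _ _)).trans (le_max_left _ _), ((le_max_right _ _).trans (le_max_right _ _)).trans (le_max_left _ _),
      ((le_max_left _ _).trans (le_max_left _ _)).trans (le_max_right _ _), ((le_max_right _ _).trans (le_max_left _ _)).trans (le_max_right _ _),
      ((le_max_left _ _).trans (le_max_right _ _)).trans (le_max_right _ _), ((le_max_right _ _).trans (le_max_right _ _)).trans (le_max_right _ _)⟩
  -- §2 THE SECOND STATE LAYER at (δK, δP) above the threshold `max M₀ MW`, level-13 slots at δ13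
  obtain ⟨MD, aD, θ₂, haD0, haDa, hθ₂0, hD2P⟩ :=
    N06D2SupPrechainV2AtPinsPUWQ.d2sup_prechain_v2_of_pins_knit (N := N) (θ := θ) (Mstar := Mstar) (H := H) (bI := bI) (hlev := hlev) (hβ1 := hβ1) (hbI0 := hbI0) (hGR := hGR) (c := c) (M₀ := max M₀ MW) (a₀ := a₀) (hM₀ := hM₀.trans (le_max_left M₀ MW)) (hσ := hσ) (hτ := hτ)
      (w13 := w13) (hw13₀ := hw13₀) (hw13₁ := hw13₁) (wX := wX) (hwX₀ := hwX₀) (hwX₁ := hwX₁) (hs440 := hs440) (hs441 := hs441) (hw1344 := hw1344) (hwX44 := hwX44) (bH13 := bH13) (hbH13 := hbH13) (hκ13 := hκ13) (bXH := bXH) (hbXH := hbXH) (bHXA := bHXA) (hbHXA := hbHXA) (bW := fun x U => bHXT x U) (CW := (Real.exp (1 * (rNear θ.d₆ θ.ℓ₆ + 1)) * max c₁R 0 * Real.exp ((δ13 - τ) * (rNear θ.d₆ θ.ℓ₆ + 1)))) (hCW := by positivity) (htransW := fun x hMz U ε hε K hK h => by letI : Fintype (B9GeoNormsKLevelV1.geo9K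 x.toKIdx).Site := (inferInstance : Fintype (geo9Y x).Site); rw [hbHXT x U]; exact (hasMaj_bHZPIfam_of_supBlocks x.toKIdx (trBasis N) (hβ1 x) (B9SmoothHolderClassTClosure.abs_cf_eq_nKT x.toKIdx x.hcfk) (taxiS x.toKIdx (bg9YR (Matrix (Fin N) (Fin N) ℂ) (specialUnitaryUnits (Fin N)) R₁ R₂ x) (fun U => U) U) ε (fun y => (hrowR x (hMLRW.trans ((le_max_right M₀ MW).trans hMz)) y).trans (le_max_left c₁R 0)) zero_le_one hK (by linarith only [hP3, hKP, hδK0, hσ, hτ]) h).mono fun a a' => le_of_eq rfl) (𝔬12 := 𝔬12) (hblk12 := hblk12) (hblkW12 := hblkW12) (𝔠 := 𝔠) (Δ2 := Δ2) (hΔ2def := hΔ2def) (hTpico12 := hTpico12) (hDvco12 := hDvco12) (hDvsco12 := hDvsco12) (𝔭A := 𝔭A) (hparB := hparB) (h𝔭A := h𝔭A) (Dd := fun x => (𝔡A x).Dd) (Dsd := fun x => (𝔡A x).Dsd) (hDd := h𝔡Ad) (Gp := fun x => GpY x.toKIdx (parKnitY x.toKIdx)) (hGp := fun _ => rfl) (parS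 := fun x => parKnitY x.toKIdx) (hparS := fun _ => rfl)
      (hB₀ := hB₀) (hCP := hCP) (htJ := htJ) (hB43 := hB43) (htA := htA) (hB44 := hB44) (B12₃ := max Bz BZv) (Bx13 := fun β => max Bxz (KX * Bh12 β)) (hB12₃ := hBz.trans (le_max_left Bz BZv)) (hBx13 := hBxM) (hBx13₀ := hBx0M) (hwBx13 := hwBxM) (hB12₀ := hB12₀) (hBh12 := hBh12) (hBi := hBi12) (B₀G := B12₀) (δ₀G := δ12₀) (hB₀G := hB12₀) (hBhG := fun s hs0 hs1 => hBh12 s hs0.le hs1) (hBHG := hBHG) (hwBhG := hwBhG) (hBd := hBdT) (hB₃ := hB₃) (hBhD := hBhD) (hBdX := hBdX) (δK := δK) (δP := δP) (hδK := hδK0) (hr0 := hr0) (hr49 := hr49) (hr2 := hr2) (hr44 := hr44) (hrB := hrB) (hr43 := hr43) (hrT := hrT) (hK3d := hK3d) (hKP := hKP) (hP0 := hP0) (hP3 := hP3) (hPG := by linarith only [hP0, hτ]) (h31 := fun x hMz => h31 x ((le_max_left M₀ MW).trans hMz))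
      (h49 := fun x hMz => h49 x ((le_max_left M₀ MW).trans hMz)) (h43 := fun x hMz => h43 x ((le_max_left M₀ MW).trans hMz)) (h44G := fun x hMz => h44G x ((le_max_left M₀ MW).trans hMz)) (hta := fun x hMz => hta x ((le_max_left M₀ MW).trans hMz)) (hBJ := fun x hMz => hBJ x ((le_max_left M₀ MW).trans hMz)) (hZ81 := fun x hMz α₀ hα ha U hU hU' => ((hDV x (hMDvW.trans ((le_max_right M₀ MW).trans hMz)) α₀ hα ha U hU hU').1).mono (kernel_mono (hG' x) hBZv (le_max_right Bz BZv) le_rfl)) (hpXDv := (fun x hMz α₀ hα ha U hU hU' β h0 h1 => (hPX x (hMDxW.trans ((le_max_right M₀ MW).trans hMz)) α₀ hα ha U hU hU' β h0 h1).mono (kernel_mono (hG' x) (hBxK β h0 h1) (le_max_right Bxz (KX * Bh12 β)) le_rfl))) (he0 := fun x hMz α₀ hα ha U hU hU' => (hG0 x ((le_max_left M₀ MW).trans hMz) α₀ hα ha U hU hU').e0) (he1d := fun x hMz α₀ hα ha U hU hU' => (hG0D x ((le_max_left M₀ MW).trans hMz) α₀ hα ha U hU hU').e1d) (he2 := fun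 x hMz α₀ hα ha U hU hU' => (hG0 x ((le_max_left M₀ MW).trans hMz) α₀ hα ha U hU hU').e2) (h43RG := fun x hMz α₀ hα ha U hU hU' s' hs0 hs1 => (hG0D x ((le_max_left M₀ MW).trans hMz) α₀ hα ha U hU hU').h43R s' hs0.le hs1)
      (hgQs1 := fun x hMz α₀ hα ha U hU hU' => ((hGT x (hMzW.trans ((le_max_right M₀ MW).trans hMz)) α₀ hα ha U hU hU').1).mono (kernel_mono (hG' x) hBz (le_max_left Bz BZv) le_rfl)) (hpXQs := (fun x hMz α₀ hα ha U hU hU' β h0 h1 => ((hGT x (hMzW.trans ((le_max_right M₀ MW).trans hMz)) α₀ hα ha U hU hU').2 β h0 h1).mono (kernel_mono (hG' x) hBxz (le_max_left Bxz (KX * Bh12 β)) le_rfl))) (hDirR := fun x hMz α₀ hα ha U hU hU' => hG0DR x ((le_max_left M₀ MW).trans hMz) α₀ hα ha U hU hU') (hDir := fun x hMz α₀ hα ha U hU hU' => (hG0D x ((le_max_left M₀ MW).trans hMz) α₀ hα ha U hU hU').h44m) (hdgDvd := fun x hMz α₀ hα ha U hU hU' ν ε hε => (hLEG x (hMDLW.trans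 ((le_max_right M₀ MW).trans hMz)) α₀ hα ha U hU hU').1 ν ε hε) (he1 := fun x hMz => he1 x ((le_max_left M₀ MW).trans hMz)) (h43L := fun x hMz α₀ hα ha U hU hU' => (hG0D x ((le_max_left M₀ MW).trans hMz) α₀ hα ha U hU hU').h43L) (h43d := fun x hMz α₀ hα ha U hU hU' => (hG0D x ((le_max_left M₀ MW).trans hMz) α₀ hα ha U hU hU').h43d)
      (hdgDH := fun x hMz α₀ hα ha U hU hU' => (hDg x (hMDgW.trans ((le_max_right M₀ MW).trans hMz)) α₀ hα ha U hU hU').2) (hdgDHd := fun x hMz α₀ hα ha U hU hU' => (hDg x (hMDgW.trans ((le_max_right M₀ MW).trans hMz)) α₀ hα ha U hU hU').1) (hYd := fun x hMz => hYd x (hMYdW.trans ((le_max_right M₀ MW).trans hMz))) (hXd := fun x hMz => hXd x (hMXdW.trans ((le_max_right M₀ MW).trans hMz)))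
      (ha₀ := ha₀) (hinvG0 := fun x hMz => hinvG0 x ((le_max_left M₀ MW).trans hMz)) (hpos12 := fun x hMz => hpos12 x ((le_max_left M₀ MW).trans hMz)) (hsym12 := fun x hMz => hsym12 x ((le_max_left M₀ MW).trans hMz)) (hBL0 := hBL0) (ht2L := ht2L) (hσF := hσF) (hσF0 := hσF0) (hσFT := hσFT) (hl0 := fun x hMz => hl0 x ((le_max_left M₀ MW).trans hMz)) (htpi := fun x hMz => htpi x ((le_max_left M₀ MW).trans hMz)) (hρG := hρG) (hρGP := hρGP) (hρGK := hρGK) (hS0co12 := hS0co12) (hblkZ12 := hblkZ12) (hGco12 := hGco12) (hCco12 := hCco12) (hRP2 := hRP2) (hκC := hκC) (hgap := hgap) (T₀ := O) (hT₀ := hO) (hG0co12 := hG0co12) (a311 := a311) (M311 := M311) (ha311 := ha311) (hM311 := hM311) (hΔ := hΔ) (𝔮 := 𝔮) (𝔮s := 𝔮s) (h𝔮 := h𝔮) (h𝔮s := h𝔮s) (hadj := hadj) (Δ := Δ) (hΔdef := hΔdef) (hc := hc10) (hRP := hP) (hα' := hα') (hαQ := hαQ) (hα3 := hα3) (hα2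 := hα2) (haK := haK) (hKpl := hKpl) (hT16 := hT16) (hGDsym := fun x hMz => hGDsym x ((le_max_left M₀ MW).trans hMz)) (BQ := BQ15) (hBQ := hBQ15) (hQ15 := fun x hMz => hQ15 x ((le_max_left M₀ MW).trans hMz)) (hnbr := hnbr) (hC2 := fun x hMz => hC2 x ((le_max_left M₀ MW).trans hMz))
  -- §2b THE U8 STATE LAYER of record at (δK, δP) on the sub-regime aD, fed the derived Δ⁽²⁾ letter
  obtain ⟨MTS, θS, θD12, A₀S, AWS, AQS, ADS, AQ1S, CRS, θH12, AIS, AVS, hθS, hθD12, hθH12, hA₀S, hAWS, hAQS, hADS, hAQ1S, hCRS, hAIS, hAVS, hST⟩ :=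
    N06StateLayerAtPinsPUWPar.hStateTuplesW_of_pinsP_geo9Y_par (parT := fun i => parKnitY i) (N := N) (H := H) (bI := bI) (hlev := hlev) (hβ1 := hβ1) (hbI0 := hbI0) (hGR := hGR) (c := c) (M₀ := max (max M₀ MW) MD) (a₀ := aD) (hM₀ := hM₀.trans ((le_max_left M₀ MW).trans (le_max_left _ MD))) (hσ := hσ) (hτ := hτ)
      (w13 := w13) (hw13₀ := hw13₀) (hw13₁ := hw13₁) (wX := wX) (hwX₀ := hwX₀) (hwX₁ := hwX₁) (hs440 := hs440) (hs441 := hs441) (hw1344 := hw1344) (hwX44 := hwX44) (bH13 := bH13) (hbH13 := hbH13) (hκ13 := hκ13) (bXH := bXH) (hbXH := hbXH) (bHXA := bHXA) (hbHXA := hbHXA) (bW := fun x U => bHXT x U) (CW := (Real.exp (1 * (rNear θ.d₆ θ.ℓ₆ + 1)) * max c₁R 0 * Real.exp ((δ13 - τ) * (rNear θ.d₆ θ.ℓ₆ + 1)))) (hCW := by positivity) (htransW := fun x hMz U ε hε K hK h => by letI : Fintype (B9GeoNormsKLevelV1.geo9K x.toKIdx).Site := (inferInstance : Fintype (geo9Y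 x).Site); rw [hbHXT x U]; exact (hasMaj_bHZPIfam_of_supBlocks x.toKIdx (trBasis N) (hβ1 x) (B9SmoothHolderClassTClosure.abs_cf_eq_nKT x.toKIdx x.hcfk) (taxiS x.toKIdx (bg9YR (Matrix (Fin N) (Fin N) ℂ) (specialUnitaryUnits (Fin N)) R₁ R₂ x) (fun U => U) U) ε (fun y => (hrowR x (hMLRW.trans ((le_max_right M₀ MW).trans ((le_max_left _ MD).trans hMz))) y).trans (le_max_left c₁R 0)) zero_le_one hK (by linarith only [hP3, hKP, hδK0, hσ, hτ]) h).mono fun a a' => le_of_eq rfl) (𝔬12 := 𝔬12) (hblk12 := hblk12) (hblkW12 := hblkW12) (Δ2 := Δ2) (hTpico12 := hTpico12) (hT2co12 := hT2co12) (hDvco12 := hDvco12) (hDvsco12 := hDvsco12) (𝔭A := 𝔭A) (hparB := hparB) (h𝔭A := h𝔭A) (Dd := fun x => (𝔡A x).Dd) (Dsd := fun x => (𝔡A x).Dsd) (hDd := h𝔡Ad) (Gp := fun x => GpY x.toKIdx (parKnitY x.toKIdx)) (hGp := fun _ => rfl) (parS := fun x => parKnitY x.toKIdx) (hparS := fun _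 => rfl)
      (hB₀ := hB₀) (hCP := hCP) (htJ := htJ) (hB43 := hB43) (htA := htA) (hB44 := hB44) (B12₃ := max Bz BZv) (Bx13 := fun β => max Bxz (KX * Bh12 β)) (hB12₃ := hBz.trans (le_max_left Bz BZv)) (hBx13 := hBxM) (hBx13₀ := hBx0M) (hwBx13 := hwBxM) (hB12₀ := hB12₀) (hBh12 := hBh12) (hBi := hBi12) (B₀G := B12₀) (δ₀G := δ12₀) (hB₀G := hB12₀) (hBhG := fun s hs0 hs1 => hBh12 s hs0.le hs1) (hBHG := hBHG) (hwBhG := hwBhG) (hBd := hBdT) (hB₃ := hB₃) (hBhD := hBhD) (hBdX := hBdX) (δK := δK) (δP := δP) (hδK := hδK0) (hr0 := hr0) (hr49 := hr49) (hr2 := hr2) (hr44 := hr44) (hrB := hrB) (hr43 := hr43) (hrT := hrT) (hK3d := hK3d) (hKP := hKP) (hP0 := hP0) (hP3 := hP3) (hPG := by linarith only [hP0, hτ]) (h31 := fun x hMz α₀ hα ha => h31 x ((le_max_left M₀ MW).trans ((le_max_left _ MD).trans hMz)) α₀ hα (ha.trans haDa))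
      (h49 := fun x hMz α₀ hα ha => h49 x ((le_max_left M₀ MW).trans ((le_max_left _ MD).trans hMz)) α₀ hα (ha.trans haDa)) (h43 := fun x hMz α₀ hα ha => h43 x ((le_max_left M₀ MW).trans ((le_max_left _ MD).trans hMz)) α₀ hα (ha.trans haDa)) (h44G := fun x hMz α₀ hα ha => h44G x ((le_max_left M₀ MW).trans ((le_max_left _ MD).trans hMz)) α₀ hα (ha.trans haDa)) (hθ₂ := hθ₂0) (hD2 := fun x hMz => hD2P x ((le_max_right _ MD).trans hMz)) (hta := fun x hMz α₀ hα ha => hta x ((le_max_left M₀ MW).trans ((le_max_left _ MD).trans hMz)) α₀ hα (ha.trans haDa)) (hBJ := fun x hMz α₀ hα ha => hBJ x ((le_max_left M₀ MW).trans ((le_max_left _ MD).trans hMz)) α₀ hα (ha.trans haDa)) (hZ81 := fun x hMz α₀ hα ha U hU hU' => ((hDV x (hMDvW.trans ((le_max_right M₀ MW).trans ((le_max_left _ MD).trans hMz))) α₀ hα (ha.trans haDa) U hU hU').1).mono (kernel_mono (hG' x) hBZv (le_max_right Bz BZv) le_rfl)) (hpXDv := (fun x hMz α₀ hα ha U hU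 hU' β h0 h1 => (hPX x (hMDxW.trans ((le_max_right M₀ MW).trans ((le_max_left _ MD).trans hMz))) α₀ hα (ha.trans haDa) U hU hU' β h0 h1).mono (kernel_mono (hG' x) (hBxK β h0 h1) (le_max_right Bxz (KX * Bh12 β)) le_rfl))) (he0 := fun x hMz α₀ hα ha U hU hU' => (hG0 x ((le_max_left M₀ MW).trans ((le_max_left _ MD).trans hMz)) α₀ hα (ha.trans haDa) U hU hU').e0) (he1d := fun x hMz α₀ hα ha U hU hU' => (hG0D x ((le_max_left M₀ MW).trans ((le_max_left _ MD).trans hMz)) α₀ hα (ha.trans haDa) U hU hU').e1d) (he2 := fun x hMz α₀ hα ha U hU hU' => (hG0 x ((le_max_left M₀ MW).trans ((le_max_left _ MD).trans hMz)) α₀ hα (ha.trans haDa) U hU hU').e2) (h43RG := fun x hMz α₀ hα ha U hU hU' s' hs0 hs1 => (hG0D x ((le_max_left M₀ MW).trans ((le_max_left _ MD).trans hMz)) α₀ hα (ha.trans haDa) U hU hU').h43R s' hs0.le hs1)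
      (hgQs1 := fun x hMz α₀ hα ha U hU hU' => ((hGT x (hMzW.trans ((le_max_right M₀ MW).trans ((le_max_left _ MD).trans hMz))) α₀ hα (ha.trans haDa) U hU hU').1).mono (kernel_mono (hG' x) hBz (le_max_left Bz BZv) le_rfl)) (hpXQs := (fun x hMz α₀ hα ha U hU hU' β h0 h1 => ((hGT x (hMzW.trans ((le_max_right M₀ MW).trans ((le_max_left _ MD).trans hMz))) α₀ hα (ha.trans haDa) U hU hU').2 β h0 h1).mono (kernel_mono (hG' x) hBxz (le_max_left Bxz (KX * Bh12 β)) le_rfl))) (hDirR := fun x hMz α₀ hα ha U hU hU' => hG0DR x ((le_max_left M₀ MW).trans ((le_max_left _ MD).trans hMz)) α₀ hα (ha.trans haDa) U hU hU') (hDir := fun x hMz α₀ hα ha U hU hU' => (hG0D x ((le_max_left M₀ MW).trans ((le_max_left _ MD).trans hMz)) α₀ hα (ha.trans haDa) U hU hU').h44m) (hdgDvd := fun x hMz α₀ hα ha U hU hU' ν ε hε => (hLEG x (hMDLW.trans ((le_max_right M₀ MW).trans ((le_max_left _ MD).trans hMz))) α₀ hα (ha.trans haDa) U hU hU').1 ν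 ε hε) (he1 := fun x hMz α₀ hα ha => he1 x ((le_max_left M₀ MW).trans ((le_max_left _ MD).trans hMz)) α₀ hα (ha.trans haDa)) (h43L := fun x hMz α₀ hα ha U hU hU' => (hG0D x ((le_max_left M₀ MW).trans ((le_max_left _ MD).trans hMz)) α₀ hα (ha.trans haDa) U hU hU').h43L) (h43d := fun x hMz α₀ hα ha U hU hU' => (hG0D x ((le_max_left M₀ MW).trans ((le_max_left _ MD).trans hMz)) α₀ hα (ha.trans haDa) U hU hU').h43d)
      (hdgDH := fun x hMz α₀ hα ha U hU hU' => (hDg x (hMDgW.trans ((le_max_right M₀ MW).trans ((le_max_left _ MD).trans hMz))) α₀ hα (ha.trans haDa) U hU hU').2) (hdgDHd := fun x hMz α₀ hα ha U hU hU' => (hDg x (hMDgW.trans ((le_max_right M₀ MW).trans ((le_max_left _ MD).trans hMz))) α₀ hα (ha.trans haDa) U hU hU').1) (hYd := fun x hMz α₀ hα ha => hYd x (hMYdW.trans ((le_max_right M₀ MW).trans ((le_max_left _ MD).trans hMz))) α₀ hα (ha.trans haDa)) (hXd := fun x hMz α₀ hα ha => hXd x (hMXdW.trans ((le_max_right M₀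 MW).trans ((le_max_left _ MD).trans hMz))) α₀ hα (ha.trans haDa))
  -- §3 ONE THRESHOLD for every output
  have hW3 : max M₀ MW ≤ max (max (max M₀ MW) MD) MTS := (le_max_left _ _).trans (le_max_left _ _)
  have hMWS : M₀ ≤ max (max (max M₀ MW) MD) MTS := (le_max_left _ _).trans hW3
  refine ⟨max (max (max M₀ MW) MD) MTS, aD, θ₂, BdT, Bd2T, BdX, BhD, BZv, BXv, BLv, KX, Bz, Bxz, θS, θD12, A₀S, AWS, AQS, ADS, AQ1S, CRS, θH12, AIS, AVS,
    hMWS, haD0, haDa, hθ₂0, hBdT, hBd2T, hBdX, hBhD, hBZv, hBXv, hBLv, hKX, hBz, hBxz, hθS, hθD12, hθH12, hA₀S, hAWS, hAQS, hADS, hAQ1S, hCRS, hAIS, hAVS,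
    fun x hM => hLEG x ((hMDLW.trans (le_max_right M₀ MW)).trans (hW3.trans hM)),
    fun x hM => hXd x ((hMXdW.trans (le_max_right M₀ MW)).trans (hW3.trans hM)),
    fun x hM => hDg x ((hMDgW.trans (le_max_right M₀ MW)).trans (hW3.trans hM)),
    fun x hM => hYd x ((hMYdW.trans (le_max_right M₀ MW)).trans (hW3.trans hM)),
    fun x hM => hDV x ((hMDvW.trans (le_max_right M₀ MW)).trans (hW3.trans hM)),
    fun x hM => hPX x ((hMDxW.trans (le_max_right M₀ MW)).trans (hW3.trans hM)),
    fun x hM => hGT x ((hMzW.trans (le_max_right M₀ MW)).trans (hW3.trans hM)),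
    fun x hM => hD2P x (((le_max_right _ MD).trans (le_max_left _ MTS)).trans hM),
    fun x hM => hST x ((le_max_right _ _).trans hM)⟩

end Summit.QuantumFields.YangMills.BalabanUVNodes.N06Level13D2LayerAtPinsPUWParQ
end
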